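import Literature.NumberTheory.LFunctions.XiSecondDerivativeZeroCountingFunction
import Literature.NumberTheory.LFunctions.XiHigherDerivativesModulusMonotone
import Literature.NumberTheory.LFunctions.ZeroCountingDerivZetaProofs
import HarnessLib

/-!
# The zero-counting function of `ξ^{(m)}` for every `m`: `N^{(m)}(T) = N(T) + O_m(log T)` (Conrey 1983, Lemma 2)

RH-FREE (every statement below is an unconditional theorem of this tree; nothing here bears on the
truth of RH). Topic `Literature/NumberTheory/LFunctions`, namespace `Literature.NumberTheory.LFunctions`
(helpers in `XiDerivMArg`). PROOF LAYER for `XiDerivativeZeros.lean` (J. B. Conrey, *Zeros of derivatives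
of Riemann's ξ-function on the critical line*, J. Number Theory **16** (1983) 49–74, key `Conrey1983`):
the COUNTING PART of Lemma 2 (p. 52) for EVERY `m` — "If `N^{(m)}(T)` denotes the number of zeros of
`ξ^{(m)}(s)` with `0 < t < T`, then `N^{(m)}(T) = (T/2π) log(T/2π) − T/2π + O_m(log T)`. … The second
statement of the Lemma can be proven by the argument principle and parts (a), (b), and (c) of Lemma 1.
The proof is similar to Backlund's proof of the assertion in the case `m = 0`." The tree has `m = 1`
(`XiDerivativeZeroCountingFunction.lean`) and `m = 2` (`XiSecondDerivativeZeroCountingFunction.lean`) with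
explicit constants; here the same Backlund argument is run uniformly in `m` (constants existential):

* `F_m = ξ^{(m+1)}/ξ^{(m)}` is odd under `s ↦ 1 − s` and real-symmetric; all zeros of `ξ^{(m)}` lie in
  `0 < Re s < 1` (`Conrey1983_lemma2_strip`), the real ones only at `½` (Freitas 2006 Thm 2.2, tree
  `Freitas2006_thm_2_2_holds`); the argument principle on `[−1,2] × [−T,T]` folds to the quarter path:
  `A_m − B_m = π N^{(m)}(T) + (π/2) c_m`, `c_m` the multiplicity of `ξ^{(m)}` at `½` (`quarter_path_eq`);
* vertical edge: `F_{j+1} − F_j` is the logarithmic derivative of `ξ^{(j+1)}/ξ^{(j)}`, which has positive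
  real part on `Re s = 2` (Conrey's inequality, tree `re_iteratedDeriv_succ_div_pos_of_one_le_re`), so
  `|A_{j+1} − A_j| ≤ π` and `|A_m − A_0| ≤ m π` (`abs_vertical_sub_le`);
* horizontal edge: with `G = 1/s + 1/(s−1) + Γℝ′/Γℝ` and the operator `D φ = φ′ + G φ`, the functions
  `h_m = D^m ζ` are analytic on `Re s > 0`, `s ≠ 1`, and `h_m = ζ · ξ^{(m)}/ξ` (`iterate_eq_zeta_mul`),
  so `F_m − F_0 = h_m′/h_m − ζ′/ζ` near the segment; `|h_m| ≤ (8(m+1) + 7 + log(T+6)/2)^m · 40(T+4)` on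
  `|s − (2+iT)| ≤ 7/4 − m/(8(m+1))` (Cauchy steps of radius `1/(8(m+1))`, `norm_iterate_le`), while
  `|h_m(2+iT)| = |ζ(2+iT)| ∏_{j<m} |F_j(2+iT)|` is bounded below polynomially in `T` by the QUANTITATIVE
  Jensen-circle sign lemma (`XiDeriv2Arg.im_mul_im_logDeriv_le`) applied to `Ξ^{(j)}` and one of its zeros
  (`re_iteratedDeriv_succ_div_two_add_ge`); Backlund's lemma then bounds the argument of `h_m`.

Results: **`exists_abs_xiDerivZeroCount_sub_zetaZeroCount_le_log_all`** (`∀ m, N^{(m)}(T) − N(T) = O_m(log T)`),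
**`xiDerivZeroCount_riemann_von_mangoldt`** (Conrey's printed form, every `m`), `N^{(m)}/N → 1`, and —
with the `m`-fold Rolle bound of `XiHigherDerivativesCriticalZeros.lean` and [AF26] Theorem A —
**`two_thirds_le_xiDerivCriticalLineProportion`** (`∀ m, 2/3 ≤ κ′_m`) and
**`xiDerivCriticalLineProportion_ge_06725`** (`∀ m, 0.6725 ≤ κ′_m`), unconditionally (Conrey's
`κ′_m ≥ 0.8137, 0.9584, …`, Levinson's method, are NOT proved here). AI-produced formalisation
(literature-prover-rh-lit-frontier-1-g12-0, 2026-08-27); AI review is weaker than expert review. No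
endorsement of any preprint is implied.

## References

* J. B. Conrey, J. Number Theory 16 (1983) 49–74: Lemma 1 (p. 51), Lemma 2 (p. 52). [key `Conrey1983`]
* E. C. Titchmarsh, *The Theory of the Riemann Zeta-Function*, 2nd ed., §9.3–9.4. [key `Titchmarsh1986`]
-/

noncomputable section

open Complex Filter Set MeasureTheory Metric
open scoped Real Topology ComplexConjugate

namespace Literature.NumberTheory.LFunctions

open Literature.Analysis.Complex

namespace XiDerivMArg

/-! ## §1. `ξ^{(m)}` and `F_m = ξ^{(m+1)}/ξ^{(m)}`: analyticity, symmetries, real zeros -/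

/-- `ξ^{(m)}` is differentiable. [cite: Conrey1983, Lemma 2 proof (p. 52)] -/
theorem differentiable_iter (m : ℕ) : Differentiable ℂ (iteratedDeriv m riemannXi) :=
  differentiable_iteratedDeriv_of_entire differentiable_riemannXi m

/-- `deriv ξ^{(m)} = ξ^{(m+1)}`. [cite: Conrey1983, §1 (p. 49)] -/
theorem deriv_iter (m : ℕ) : deriv (iteratedDeriv m riemannXi) = iteratedDeriv (m + 1) riemannXi := by
  rw [iteratedDeriv_succ]

/-- `F_m(1 − s) = −F_m(s)`. [cite: Conrey1983, Lemma 2 proof (p. 52): ξ^{(m)}(s) = (−1)^m ξ^{(m)}(1 − s)] -/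
theorem logDeriv_iter_one_sub (m : ℕ) (s : ℂ) :
    iteratedDeriv (m + 1) riemannXi (1 - s) / iteratedDeriv m riemannXi (1 - s) =
      -(iteratedDeriv (m + 1) riemannXi s / iteratedDeriv m riemannXi s) := by
  rw [XiDerivMonotone.iteratedDeriv_riemannXi_one_sub, XiDerivMonotone.iteratedDeriv_riemannXi_one_sub,
    pow_succ]
  by_cases h : iteratedDeriv m riemannXi s = 0
  · simp [h]
  · have h1 : ((-1 : ℂ) ^ m) ≠ 0 := pow_ne_zero _ (by norm_num)
    field_simp

/-- `F_m(s̄) = conj F_m(s)`. [cite: Conrey1983, Lemma 2 proof (p. 52)] -/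
theorem logDeriv_iter_conj (m : ℕ) (s : ℂ) :
    iteratedDeriv (m + 1) riemannXi (conj s) / iteratedDeriv m riemannXi (conj s) =
      conj (iteratedDeriv (m + 1) riemannXi s / iteratedDeriv m riemannXi s) := by
  rw [iteratedDeriv_conj_of_conj riemannXi_conj_holds, iteratedDeriv_conj_of_conj riemannXi_conj_holds,
    map_div₀]

/-- `F_m` is continuous wherever `ξ^{(m)} ≠ 0`. [cite: Conrey1983, Lemma 2 proof (p. 52)] -/
theorem continuousAt_logDeriv_iter (m : ℕ) {s : ℂ} (hs : iteratedDeriv m riemannXi s ≠ 0) :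
    ContinuousAt (fun z ↦ iteratedDeriv (m + 1) riemannXi z / iteratedDeriv m riemannXi z) s :=
  (differentiable_iter (m + 1) s).continuousAt.div (differentiable_iter m s).continuousAt hs

/-- If no zero of `ξ^{(m)}` has ordinate `T`, then `ξ^{(m)} ≠ 0` on the lines `Im s = ±T`.
[cite: Conrey1983, Lemma 2 proof (p. 52)] -/
theorem iter_ne_zero_of_im_eq (m : ℕ) {T : ℝ}
    (hT' : ∀ ρ : ℂ, iteratedDeriv m riemannXi ρ = 0 → ρ.im ≠ T) {s : ℂ} (hs : s.im = T ∨ s.im = -T) :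
    iteratedDeriv m riemannXi s ≠ 0 := by
  intro h0
  rcases hs with hs | hs
  · exact hT' s h0 hs
  · refine hT' (conj s) (by rw [iteratedDeriv_conj_of_conj riemannXi_conj_holds, h0, map_zero]) ?_
    rw [conj_im, hs, neg_neg]

/-- **The only possible real zero of `ξ^{(m)}` is `s = ½`**: the even derivatives of `ξ` are positive on
`ℝ`, the odd ones positive right of `½` and negative left of `½` (Freitas 2006 Thm 2.2, tree
`Freitas2006_thm_2_2_holds`). [cite: Titchmarsh1986, §10.1] -/
theorem iter_ofReal_ne_zero (m : ℕ) {σ : ℝ} (hσ : σ ≠ 1 / 2) : iteratedDeriv m riemannXi σ ≠ 0 := by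
  intro h0
  obtain ⟨k, rfl | rfl⟩ := Nat.even_or_odd' m
  · have h := (Freitas2006_thm_2_2_holds σ k).1
    rw [h0, Complex.zero_re] at h
    exact lt_irrefl _ h
  · rcases lt_or_gt_of_ne hσ with hlt | hgt
    · have h := (Freitas2006_thm_2_2_holds σ k).2.2 hlt
      rw [h0, Complex.zero_re] at h
      exact lt_irrefl _ h
    · have h := (Freitas2006_thm_2_2_holds σ k).2.1 hgt
      rw [h0, Complex.zero_re] at h
      exact lt_irrefl _ h

/-! ## §2. The zeros of `ξ^{(m)}` in `(−1, 2) × (−T, T)` and their multiplicities -/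

/-- The multiplicities of `ξ^{(m)}` are symmetric under conjugation. [cite: Conrey1983, Lemma 2 proof (p. 52)] -/
theorem analyticOrderAt_iter_conj (m : ℕ) (s : ℂ) :
    analyticOrderAt (iteratedDeriv m riemannXi) (conj s) = analyticOrderAt (iteratedDeriv m riemannXi) s := by
  have ha : AnalyticAt ℂ (iteratedDeriv m riemannXi) (conj s) :=
    XiDerivCritical.analyticOnNhd_iteratedDeriv_riemannXi m _ trivial
  rw [← analyticOrderAt_conj_conj ha]
  congr 1
  funext z
  rw [iteratedDeriv_conj_of_conj riemannXi_conj_holds, conj_conj]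

/-- `(meromorphicOrderAt ξ^{(m)} s).untop₀ = (analyticOrderAt ξ^{(m)} s).toNat` (as complex numbers).
[cite: Conrey1983, Lemma 2 proof (p. 52)] -/
theorem untop₀_meromorphicOrderAt_iter (m : ℕ) (s : ℂ) :
    ((meromorphicOrderAt (iteratedDeriv m riemannXi) s).untop₀ : ℂ) =
      ((analyticOrderAt (iteratedDeriv m riemannXi) s).toNat : ℂ) := by
  have ha : AnalyticAt ℂ (iteratedDeriv m riemannXi) s :=
    XiDerivCritical.analyticOnNhd_iteratedDeriv_riemannXi m _ trivial
  obtain ⟨n, hn⟩ := ENat.ne_top_iff_exists.mp (XiDerivCritical.analyticOrderAt_ne_top m s)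
  rw [ha.meromorphicOrderAt_eq, ← hn, ENat.map_coe, WithTop.untop₀_coe, ENat.toNat_coe]
  norm_cast

/-- **The zeros of `ξ^{(m)}` in the open rectangle `(−1, 2) × (−T, T)`**, for `T > 0` not an ordinate of a
zero of `ξ^{(m)}`: the zeros with `0 < Im s ≤ T` (`xiDerivZeroBox m T`), their conjugates, and possibly the
real point `s = ½`. [cite: Conrey1983, Lemma 2 (p. 52)] -/
theorem setOf_iter_eq_zero_eq_union (m : ℕ) {T : ℝ} (hT : 0 < T)
    (hT' : ∀ ρ : ℂ, iteratedDeriv m riemannXi ρ = 0 → ρ.im ≠ T) :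
    {ρ : ℂ | iteratedDeriv m riemannXi ρ = 0 ∧ ρ ∈ Ioo (-1 : ℝ) 2 ×ℂ Ioo (-T) T} =
      (xiDerivZeroBox m T ∪ conj '' xiDerivZeroBox m T) ∪
        ({1 / 2} ∩ {ρ | iteratedDeriv m riemannXi ρ = 0}) := by
  ext ρ
  simp only [mem_setOf_eq, mem_reProdIm, mem_Ioo, mem_union, mem_image, mem_inter_iff,
    mem_singleton_iff, xiDerivZeroBox]
  constructor
  · rintro ⟨h0, ⟨-, -⟩, him1, him2⟩
    rcases lt_trichotomy ρ.im 0 with hneg | hzero | hpos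
    · left; right
      refine ⟨conj ρ, ⟨by rw [iteratedDeriv_conj_of_conj riemannXi_conj_holds, h0, map_zero], ?_, ?_⟩,
        conj_conj ρ⟩
      · rw [conj_im]; linarith
      · rw [conj_im]
        have : (conj ρ).im ≠ T := hT' (conj ρ)
          (by rw [iteratedDeriv_conj_of_conj riemannXi_conj_holds, h0, map_zero])
        rw [conj_im] at this
        exact le_of_lt (lt_of_le_of_ne (by linarith) this)
    · right
      have hρ : ρ = (ρ.re : ℂ) := by
        apply Complex.ext <;> simp [hzero]
      refine ⟨?_, h0⟩
      by_contra hne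
      rw [hρ] at h0
      refine iter_ofReal_ne_zero m (σ := ρ.re) (fun h ↦ hne ?_) h0
      rw [hρ, h]; push_cast; ring
    · left; left
      exact ⟨h0, hpos, le_of_lt (lt_of_le_of_ne him2.le (hT' ρ h0))⟩
  · rintro ((⟨h0, h1, h2⟩ | ⟨w, ⟨h0, h1, h2⟩, rfl⟩) | ⟨h, h0⟩)
    · have hst := Conrey1983_lemma2_strip m h0
      exact ⟨h0, ⟨by linarith [hst.1], by linarith [hst.2]⟩, by linarith,
        lt_of_le_of_ne h2 (hT' ρ h0)⟩
    · have hst := Conrey1983_lemma2_strip m h0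
      have h0' : iteratedDeriv m riemannXi (conj w) = 0 := by
        rw [iteratedDeriv_conj_of_conj riemannXi_conj_holds, h0, map_zero]
      refine ⟨h0', ⟨?_, ?_⟩, ?_, ?_⟩
      · rw [conj_re]; linarith [hst.1]
      · rw [conj_re]; linarith [hst.2]
      · rw [conj_im]; have := lt_of_le_of_ne h2 (hT' w h0); linarith
      · rw [conj_im]; linarith
    · subst h
      exact ⟨h0, ⟨by norm_num, by norm_num⟩, by simp [hT], by simp [hT]⟩

/-- `(xiDerivZeroCount m T : ℂ)` is the `finsum` of the multiplicities of `ξ^{(m)}` over the box.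
[cite: Conrey1983, Lemma 2 (p. 52)] -/
theorem xiDerivZeroCount_eq_finsum (m : ℕ) (T : ℝ) :
    (xiDerivZeroCount m T : ℂ) =
      ∑ᶠ s ∈ xiDerivZeroBox m T, ((analyticOrderAt (iteratedDeriv m riemannXi) s).toNat : ℂ) := by
  unfold xiDerivZeroCount
  have h := (AddMonoidHom.map_finsum_mem (fun s ↦ (analyticOrderAt (iteratedDeriv m riemannXi) s).toNat)
    (Nat.castAddMonoidHom ℂ) (XiDerivCritical.xiDerivZeroBox_finite m T)).symm
  simpa using h.symm

/-- **The zeros of `ξ^{(m)}` in `(−1, 2) × (−T, T)` number `2 N^{(m)}(T) + c_m`** (with multiplicity), for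
`T > 0` not an ordinate of a zero of `ξ^{(m)}`, where `c_m` is the multiplicity of `ξ^{(m)}` at `½`
(`0` for even `m`, `1` for odd `m`). [cite: Conrey1983, Lemma 2 (p. 52)] -/
theorem finsum_order_iter_eq (m : ℕ) {T : ℝ} (hT : 0 < T)
    (hT' : ∀ ρ : ℂ, iteratedDeriv m riemannXi ρ = 0 → ρ.im ≠ T) :
    ∑ᶠ ρ ∈ {ρ : ℂ | iteratedDeriv m riemannXi ρ = 0 ∧ ρ ∈ Ioo (-1 : ℝ) 2 ×ℂ Ioo (-T) T},
        ((meromorphicOrderAt (iteratedDeriv m riemannXi) ρ).untop₀ : ℂ) =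
      2 * (xiDerivZeroCount m T : ℂ) + ((analyticOrderAt (iteratedDeriv m riemannXi) (1 / 2)).toNat : ℂ) := by
  rw [setOf_iter_eq_zero_eq_union m hT hT']
  have hfin : (xiDerivZeroBox m T).Finite := XiDerivCritical.xiDerivZeroBox_finite m T
  have hdisj : Disjoint (xiDerivZeroBox m T) (conj '' xiDerivZeroBox m T) := by
    rw [Set.disjoint_left]
    rintro ρ ⟨-, h2, -⟩ ⟨w, ⟨-, hw2, -⟩, rfl⟩
    rw [conj_im] at h2
    linarith
  have hZfin : ({1 / 2} ∩ {ρ : ℂ | iteratedDeriv m riemannXi ρ = 0}).Finite :=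
    (Set.finite_singleton _).subset inter_subset_left
  have hdisj' : Disjoint (xiDerivZeroBox m T ∪ conj '' xiDerivZeroBox m T)
      ({1 / 2} ∩ {ρ : ℂ | iteratedDeriv m riemannXi ρ = 0}) := by
    rw [Set.disjoint_right]
    rintro ρ ⟨hρ, -⟩
    rw [mem_singleton_iff] at hρ
    subst hρ
    rintro (⟨-, h2, -⟩ | ⟨w, ⟨-, hw2, -⟩, hw⟩)
    · norm_num at h2
    · have := congrArg Complex.im hw
      rw [conj_im] at this
      norm_num at this
      linarith
  rw [finsum_mem_union hdisj' (hfin.union (hfin.image _)) hZfin,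
    finsum_mem_union hdisj hfin (hfin.image _),
    finsum_mem_image (starRingEnd ℂ).injective.injOn]
  simp_rw [untop₀_meromorphicOrderAt_iter, analyticOrderAt_iter_conj]
  rw [← xiDerivZeroCount_eq_finsum]
  -- the centre term
  have hcentre : ∑ᶠ ρ ∈ ({1 / 2} ∩ {ρ : ℂ | iteratedDeriv m riemannXi ρ = 0}),
      ((analyticOrderAt (iteratedDeriv m riemannXi) ρ).toNat : ℂ) =
      ((analyticOrderAt (iteratedDeriv m riemannXi) (1 / 2)).toNat : ℂ) := by
    by_cases h0 : iteratedDeriv m riemannXi (1 / 2) = 0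
    · have hset : ({1 / 2} ∩ {ρ : ℂ | iteratedDeriv m riemannXi ρ = 0}) = {(1 / 2 : ℂ)} := by
        ext ρ
        simp only [mem_inter_iff, mem_singleton_iff, mem_setOf_eq]
        exact ⟨fun h ↦ h.1, fun h ↦ ⟨h, by rw [h]; exact h0⟩⟩
      rw [hset, finsum_mem_singleton]
    · have hset : ({1 / 2} ∩ {ρ : ℂ | iteratedDeriv m riemannXi ρ = 0}) = (∅ : Set ℂ) := by
        ext ρ
        simp only [mem_inter_iff, mem_singleton_iff, mem_setOf_eq, mem_empty_iff_false, iff_false,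
          not_and]
        intro h; rw [h]; exact h0
      have hord : analyticOrderAt (iteratedDeriv m riemannXi) (1 / 2) = 0 := by
        rw [(XiDerivCritical.analyticOnNhd_iteratedDeriv_riemannXi m _ trivial).analyticOrderAt_eq_zero]
        exact h0
      rw [hset, finsum_mem_empty, hord]
      simp
  rw [hcentre]
  ring

/-! ## §3. The quarter-path identity for `ξ^{(m)}` -/

/-- **Argument principle for `ξ^{(m)}`, folded onto `2 → 2+iT → ½+iT`**: for `T > 0` not an ordinate of a
zero of `ξ^{(m)}`, with `F_m = ξ^{(m+1)}/ξ^{(m)}` and `c_m` the multiplicity of `ξ^{(m)}` at `½`,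
`∫₀ᵀ Re F_m(2+iy) dy − Im ∫_{1/2}^{2} F_m(x+iT) dx = π N^{(m)}(T) + (π/2) c_m`.
[cite: Conrey1983, Lemma 2 (p. 52)] -/
theorem quarter_path_eq (m : ℕ) {T : ℝ} (hT : 0 < T)
    (hT' : ∀ ρ : ℂ, iteratedDeriv m riemannXi ρ = 0 → ρ.im ≠ T) :
    (∫ y in (0 : ℝ)..T, (iteratedDeriv (m + 1) riemannXi (2 + y * I) /
        iteratedDeriv m riemannXi (2 + y * I)).re) -
      (∫ x in (1 / 2 : ℝ)..2, iteratedDeriv (m + 1) riemannXi (x + T * I) /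
        iteratedDeriv m riemannXi (x + T * I)).im =
      π * xiDerivZeroCount m T + π / 2 * (analyticOrderAt (iteratedDeriv m riemannXi) (1 / 2)).toNat := by
  set Fm : ℂ → ℂ := fun z ↦ iteratedDeriv (m + 1) riemannXi z / iteratedDeriv m riemannXi z with hFm
  have hAP := Literature.Analysis.Complex.integral_boundary_rect_logDeriv (f := iteratedDeriv m riemannXi)
    (a := -1) (b := 2) (c := -T) (d := T) (by norm_num) (by linarith)
    (fun z _ ↦ XiDerivCritical.analyticOnNhd_iteratedDeriv_riemannXi m z trivial)
    (fun x _ ↦ iter_ne_zero_of_im_eq m hT' (Or.inr (by simp)))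
    (fun x _ ↦ iter_ne_zero_of_im_eq m hT' (Or.inl (by simp)))
    (fun y _ ↦ iteratedDeriv_riemannXi_ne_zero_of_re_le_zero m (by simp))
    (fun y _ ↦ iteratedDeriv_riemannXi_ne_zero_of_one_le_re m (by simp))
  rw [finsum_order_iter_eq m hT hT', deriv_iter] at hAP
  have hAP' : Literature.Analysis.Complex.rectBoundaryIntegral Fm (-1) 2 (-T) T =
      2 * Real.pi * I * (2 * (xiDerivZeroCount m T : ℂ) +
        ((analyticOrderAt (iteratedDeriv m riemannXi) (1 / 2)).toNat : ℂ)) := by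
    rw [Literature.Analysis.Complex.rectBoundaryIntegral_def]
    exact hAP
  have hfold := rectBoundaryIntegral_eq_of_symmetric (F := Fm) hT.le
    (fun s ↦ logDeriv_iter_one_sub m s) (fun s ↦ logDeriv_iter_conj m s)
    (fun y _ ↦ continuousAt_logDeriv_iter m (iteratedDeriv_riemannXi_ne_zero_of_one_le_re m (by simp)))
    (fun x _ ↦ continuousAt_logDeriv_iter m (iter_ne_zero_of_im_eq m hT' (Or.inl (by simp))))
  rw [hfold] at hAP'
  set A : ℝ := ∫ y in (0 : ℝ)..T, (Fm (2 + y * I)).re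
  set B : ℂ := ∫ x in (1 / 2 : ℝ)..2, Fm (x + T * I)
  have := congrArg Complex.im hAP'
  simp only [mul_im, mul_re, I_re, I_im, ofReal_re, ofReal_im, sub_re, sub_im, re_ofNat, im_ofNat,
    natCast_re, natCast_im, add_re, add_im] at this
  simp at this
  linarith

/-! ## §4. The vertical edge: `|A_m − A_0| ≤ m π` -/

/-- Pointwise, `F_{j+1} − F_j = g_j′/g_j` for `g_j = ξ^{(j+1)}/ξ^{(j)}`, wherever `ξ^{(j)} ξ^{(j+1)} ≠ 0`.
[cite: Conrey1983, Lemma 2 proof (p. 52)] -/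
theorem logDeriv_iter_succ_sub_eq (j : ℕ) {z : ℂ} (h0 : iteratedDeriv j riemannXi z ≠ 0)
    (h1 : iteratedDeriv (j + 1) riemannXi z ≠ 0) :
    iteratedDeriv (j + 2) riemannXi z / iteratedDeriv (j + 1) riemannXi z -
        iteratedDeriv (j + 1) riemannXi z / iteratedDeriv j riemannXi z =
      deriv (fun w ↦ iteratedDeriv (j + 1) riemannXi w / iteratedDeriv j riemannXi w) z /
        (iteratedDeriv (j + 1) riemannXi z / iteratedDeriv j riemannXi z) := by
  have hd : deriv (fun w ↦ iteratedDeriv (j + 1) riemannXi w / iteratedDeriv j riemannXi w) z =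
      (deriv (iteratedDeriv (j + 1) riemannXi) z * iteratedDeriv j riemannXi z -
        iteratedDeriv (j + 1) riemannXi z * deriv (iteratedDeriv j riemannXi) z) /
          iteratedDeriv j riemannXi z ^ 2 :=
    deriv_div (differentiable_iter (j + 1) z) (differentiable_iter j z) h0
  rw [hd, deriv_iter, deriv_iter, show j + 1 + 1 = j + 2 from rfl]
  field_simp

/-- **One vertical step contributes at most `π`**: with `F_j = ξ^{(j+1)}/ξ^{(j)}`,
`|∫₀ᵀ Re F_{j+1}(2+iy) dy − ∫₀ᵀ Re F_j(2+iy) dy| ≤ π`, because the difference is `arg g_j(2+iT) − arg g_j(2)`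
for `g_j = F_j` and `Re F_j > 0` on `Re s = 2` (Conrey's inequality). [cite: Conrey1983, Lemma 2 proof (p. 52)] -/
theorem abs_vertical_step_le (j : ℕ) {T : ℝ} (hT : 0 ≤ T) :
    |(∫ y in (0 : ℝ)..T, (iteratedDeriv (j + 2) riemannXi (2 + y * I) /
        iteratedDeriv (j + 1) riemannXi (2 + y * I)).re) -
      (∫ y in (0 : ℝ)..T, (iteratedDeriv (j + 1) riemannXi (2 + y * I) /
        iteratedDeriv j riemannXi (2 + y * I)).re)| ≤ π := by
  set g : ℂ → ℂ := fun w ↦ iteratedDeriv (j + 1) riemannXi w / iteratedDeriv j riemannXi w with hg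
  set F₂ : ℂ → ℂ := fun w ↦ iteratedDeriv (j + 2) riemannXi w / iteratedDeriv (j + 1) riemannXi w
    with hF₂
  have hξ' : ∀ y : ℝ, iteratedDeriv j riemannXi (2 + y * I) ≠ 0 := fun y ↦
    iteratedDeriv_riemannXi_ne_zero_of_one_le_re j (by simp)
  have hξ'' : ∀ y : ℝ, iteratedDeriv (j + 1) riemannXi (2 + y * I) ≠ 0 := fun y ↦
    iteratedDeriv_riemannXi_ne_zero_of_one_le_re (j + 1) (by simp)
  have hre : ∀ y : ℝ, 0 < (g (2 + y * I)).re := fun y ↦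
    re_iteratedDeriv_succ_div_pos_of_one_le_re j (s := 2 + y * I) (by simp)
  have hgan : ∀ y : ℝ, AnalyticAt ℂ g (2 + y * I) := fun y ↦
    (XiDerivCritical.analyticOnNhd_iteratedDeriv_riemannXi (j + 1) _ trivial).div
      (XiDerivCritical.analyticOnNhd_iteratedDeriv_riemannXi j _ trivial) (hξ' y)
  have han : ∀ y ∈ Icc 0 T, AnalyticAt ℂ g ((2 : ℝ) + y * I) := fun y _ ↦ by
    simpa using hgan y
  have hslit : ∀ y ∈ Icc 0 T, g ((2 : ℝ) + y * I) ∈ slitPlane := fun y _ ↦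
    Or.inl (by simpa using hre y)
  have hlog := Literature.Analysis.Complex.integral_logDeriv_vertical (g := g) 2 hT han hslit
  simp only [ofReal_ofNat, ofReal_zero, zero_mul, add_zero] at hlog
  have hi1 : IntervalIntegrable (fun y : ℝ ↦ F₂ (2 + y * I)) volume 0 T := by
    have := Literature.Analysis.Complex.intervalIntegrable_of_continuousAt_vertical (F := F₂) 2 hT
      fun y _ ↦ continuousAt_logDeriv_iter (j + 1) (by simpa using hξ'' y)
    simpa using this
  have hi2 : IntervalIntegrable (fun y : ℝ ↦ g (2 + y * I)) volume 0 T := by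
    have := Literature.Analysis.Complex.intervalIntegrable_of_continuousAt_vertical (F := g) 2 hT
      fun y _ ↦ continuousAt_logDeriv_iter j (by simpa using hξ' y)
    simpa using this
  have hre1 : (∫ y in (0 : ℝ)..T, (F₂ (2 + y * I)).re) = (∫ y in (0 : ℝ)..T, F₂ (2 + y * I)).re := by
    have := ContinuousLinearMap.intervalIntegral_comp_comm (𝕜 := ℝ) reCLM hi1
    simpa using this
  have hre2 : (∫ y in (0 : ℝ)..T, (g (2 + y * I)).re) = (∫ y in (0 : ℝ)..T, g (2 + y * I)).re := by
    have := ContinuousLinearMap.intervalIntegral_comp_comm (𝕜 := ℝ) reCLM hi2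
    simpa using this
  have hsub : (∫ y in (0 : ℝ)..T, F₂ (2 + y * I)) - (∫ y in (0 : ℝ)..T, g (2 + y * I)) =
      ∫ y in (0 : ℝ)..T, deriv g (2 + y * I) / g (2 + y * I) := by
    rw [← intervalIntegral.integral_sub hi1 hi2]
    refine intervalIntegral.integral_congr fun y _ ↦ ?_
    exact logDeriv_iter_succ_sub_eq j (hξ' y) (hξ'' y)
  have key : (∫ y in (0 : ℝ)..T, (F₂ (2 + y * I)).re) - (∫ y in (0 : ℝ)..T, (g (2 + y * I)).re) =
      (Complex.log (g (2 + T * I)) - Complex.log (g 2)).im := by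
    rw [hre1, hre2, ← sub_re, hsub, ← hlog]
    simp
  show |(∫ y in (0 : ℝ)..T, (F₂ (2 + y * I)).re) - (∫ y in (0 : ℝ)..T, (g (2 + y * I)).re)| ≤ π
  rw [key, sub_im, log_im, log_im]
  have a1 := abs_arg_le_pi_div_two_iff.2 (hre T).le
  have a2 := abs_arg_le_pi_div_two_iff.2 (hre 0).le
  simp only [ofReal_zero, zero_mul, add_zero] at a2
  have := abs_sub (arg (g (2 + T * I))) (arg (g 2))
  linarith

/-- **The vertical edge contributes at most `m π`**: `|∫₀ᵀ Re F_m(2+iy) dy − ∫₀ᵀ Re F_0(2+iy) dy| ≤ m π`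
(telescoping `abs_vertical_step_le`). [cite: Conrey1983, Lemma 2 proof (p. 52)] -/
theorem abs_vertical_sub_le (m : ℕ) {T : ℝ} (hT : 0 ≤ T) :
    |(∫ y in (0 : ℝ)..T, (iteratedDeriv (m + 1) riemannXi (2 + y * I) /
        iteratedDeriv m riemannXi (2 + y * I)).re) -
      (∫ y in (0 : ℝ)..T, (iteratedDeriv 1 riemannXi (2 + y * I) /
        iteratedDeriv 0 riemannXi (2 + y * I)).re)| ≤ m * π := by
  induction m with
  | zero => simp
  | succ m ih =>
    have hstep := abs_vertical_step_le m hT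
    rw [show m + 1 + 1 = m + 2 from rfl]
    have := abs_sub_le
      (∫ y in (0 : ℝ)..T, (iteratedDeriv (m + 2) riemannXi (2 + y * I) /
        iteratedDeriv (m + 1) riemannXi (2 + y * I)).re)
      (∫ y in (0 : ℝ)..T, (iteratedDeriv (m + 1) riemannXi (2 + y * I) /
        iteratedDeriv m riemannXi (2 + y * I)).re)
      (∫ y in (0 : ℝ)..T, (iteratedDeriv 1 riemannXi (2 + y * I) /
        iteratedDeriv 0 riemannXi (2 + y * I)).re)
    push_cast
    linarith

/-! ## §5. The horizontal edge: `h_m = D^m ζ`, `D φ = φ′ + G φ`, with `ξ^{(m)}/ξ = h_m/ζ` -/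

/-- `h_m = D^m ζ` is analytic at every `z` with `Re z > 0`, `z ≠ 1` (`G = 1/s + 1/(s−1) + Γℝ′/Γℝ` is analytic
there). [cite: Conrey1983, Lemma 2 proof (p. 52)] -/
theorem analyticAt_iterate (m : ℕ) {z : ℂ} (hz : 0 < z.re) (hz1 : z ≠ 1) :
    AnalyticAt ℂ ((fun (φ : ℂ → ℂ) (w : ℂ) ↦ deriv φ w + (w⁻¹ + (w - 1)⁻¹ + logDeriv Gammaℝ w) * φ w)^[m] riemannZeta) z := by
  induction m generalizing z with
  | zero => simpa using analyticOn_riemannZeta z hz1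
  | succ m ih =>
    rw [Function.iterate_succ_apply']
    have hz0 : z ≠ 0 := fun h ↦ by rw [h, zero_re] at hz; exact lt_irrefl _ hz
    have hG : AnalyticAt ℂ (fun w : ℂ ↦ w⁻¹ + (w - 1)⁻¹ + logDeriv Gammaℝ w) z :=
      ((analyticAt_id.inv hz0).add ((analyticAt_id.sub analyticAt_const).inv (sub_ne_zero.2 hz1))).add
        (analyticAt_logDeriv_Gammaℝ hz)
    exact (ih hz hz1).deriv.add (hG.mul (ih hz hz1))

/-- **`h_m = ζ · ξ^{(m)}/ξ`** for `Re z > 0`, `z ≠ 1`, `ζ(z) ≠ 0` (induction: `h_{m+1} = h_m′ + G h_m`,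
`(ξ^{(m)}/ξ)′ = ξ^{(m+1)}/ξ − (ξ^{(m)}/ξ)(ξ′/ξ)`, and `ζ′ + G ζ = ζ · ξ′/ξ`).
[cite: Conrey1983, Lemma 2 proof (p. 52)] -/
theorem iterate_eq_zeta_mul (m : ℕ) {z : ℂ} (hz : 0 < z.re) (hz1 : z ≠ 1) (hζ : riemannZeta z ≠ 0) :
    ((fun (φ : ℂ → ℂ) (w : ℂ) ↦ deriv φ w + (w⁻¹ + (w - 1)⁻¹ + logDeriv Gammaℝ w) * φ w)^[m] riemannZeta) z = riemannZeta z * (iteratedDeriv m riemannXi z / riemannXi z) := by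
  induction m generalizing z with
  | zero =>
    have hξ : riemannXi z ≠ 0 := fun h0 ↦ hζ ((riemannXi_eq_zero_iff_holds z).1 h0).1
    simp only [Function.iterate_zero, id_eq, iteratedDeriv_zero]
    field_simp
  | succ m ih =>
    have hξ : riemannXi z ≠ 0 := fun h0 ↦ hζ ((riemannXi_eq_zero_iff_holds z).1 h0).1
    rw [Function.iterate_succ_apply']
    -- `h_m = ζ · ξ^{(m)}/ξ` near `z`
    have hU : ∀ᶠ w in 𝓝 z, ((fun (φ : ℂ → ℂ) (w : ℂ) ↦ deriv φ w + (w⁻¹ + (w - 1)⁻¹ + logDeriv Gammaℝ w) * φ w)^[m] riemannZeta) w =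
        riemannZeta w * (iteratedDeriv m riemannXi w / riemannXi w) := by
      have e1 : ∀ᶠ w in 𝓝 z, 0 < w.re := (isOpen_lt continuous_const continuous_re).mem_nhds hz
      have e2 : ∀ᶠ w in 𝓝 z, w ≠ 1 := eventually_ne_nhds hz1
      have e3 : ∀ᶠ w in 𝓝 z, riemannZeta w ≠ 0 :=
        (differentiableAt_riemannZeta hz1).continuousAt.eventually_ne hζ
      filter_upwards [e1, e2, e3] with w hw hw1 hwζ
      exact ih hw hw1 hwζ
    have hqd : DifferentiableAt ℂ (fun w ↦ iteratedDeriv m riemannXi w / riemannXi w) z :=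
      (differentiable_iter m z).div (differentiable_riemannXi z) hξ
    have hζd : DifferentiableAt ℂ riemannZeta z := differentiableAt_riemannZeta hz1
    have hderiv : deriv ((fun (φ : ℂ → ℂ) (w : ℂ) ↦ deriv φ w + (w⁻¹ + (w - 1)⁻¹ + logDeriv Gammaℝ w) * φ w)^[m] riemannZeta) z =
        deriv riemannZeta z * (iteratedDeriv m riemannXi z / riemannXi z) +
          riemannZeta z * deriv (fun w ↦ iteratedDeriv m riemannXi w / riemannXi w) z := by
      rw [Filter.EventuallyEq.deriv_eq hU]
      exact deriv_fun_mul hζd hqd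
    have hdq : deriv (fun w ↦ iteratedDeriv m riemannXi w / riemannXi w) z =
        (deriv (iteratedDeriv m riemannXi) z * riemannXi z -
          iteratedDeriv m riemannXi z * deriv riemannXi z) / riemannXi z ^ 2 :=
      deriv_div (differentiable_iter m z) (differentiable_riemannXi z) hξ
    rw [deriv_iter] at hdq
    have hF := logDeriv_riemannXi_eq_add_logDeriv_riemannZeta hz hz1 hζ
    show deriv ((fun (φ : ℂ → ℂ) (w : ℂ) ↦ deriv φ w + (w⁻¹ + (w - 1)⁻¹ + logDeriv Gammaℝ w) * φ w)^[m] riemannZeta) z + (z⁻¹ + (z - 1)⁻¹ + logDeriv Gammaℝ z) *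
        ((fun (φ : ℂ → ℂ) (w : ℂ) ↦ deriv φ w + (w⁻¹ + (w - 1)⁻¹ + logDeriv Gammaℝ w) * φ w)^[m] riemannZeta) z = _
    rw [hderiv, hdq, ih hz hz1 hζ]
    have hG : z⁻¹ + (z - 1)⁻¹ + logDeriv Gammaℝ z =
        deriv riemannXi z / riemannXi z - deriv riemannZeta z / riemannZeta z := by
      rw [hF]; ring
    rw [hG]
    field_simp
    ring

/-- **`F_m − F_0 = h_m′/h_m − ζ′/ζ` on the top edge**: for `Re z > 0`, `z ≠ 1`, `ζ(z) ≠ 0`, `ξ^{(m)}(z) ≠ 0`.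
[cite: Conrey1983, Lemma 2 proof (p. 52)] -/
theorem logDeriv_iter_sub_logDeriv_eq (m : ℕ) {z : ℂ} (hz : 0 < z.re) (hz1 : z ≠ 1)
    (hζ : riemannZeta z ≠ 0) (hfm : iteratedDeriv m riemannXi z ≠ 0) :
    iteratedDeriv (m + 1) riemannXi z / iteratedDeriv m riemannXi z - deriv riemannXi z / riemannXi z =
      deriv ((fun (φ : ℂ → ℂ) (w : ℂ) ↦ deriv φ w + (w⁻¹ + (w - 1)⁻¹ + logDeriv Gammaℝ w) * φ w)^[m] riemannZeta) z / ((fun (φ : ℂ → ℂ) (w : ℂ) ↦ deriv φ w + (w⁻¹ + (w - 1)⁻¹ + logDeriv Gammaℝ w) * φ w)^[m] riemannZeta) z -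
        deriv riemannZeta z / riemannZeta z := by
  set hm : ℂ → ℂ := (fun (φ : ℂ → ℂ) (w : ℂ) ↦ deriv φ w + (w⁻¹ + (w - 1)⁻¹ + logDeriv Gammaℝ w) * φ w)^[m] riemannZeta with hhm
  set g : ℂ → ℂ := fun w ↦ iteratedDeriv m riemannXi w / riemannXi w with hg
  have hξ : riemannXi z ≠ 0 := fun h0 ↦ hζ ((riemannXi_eq_zero_iff_holds z).1 h0).1
  have hU : ∀ᶠ w in 𝓝 z, g w = hm w / riemannZeta w := by
    have e1 : ∀ᶠ w in 𝓝 z, 0 < w.re := (isOpen_lt continuous_const continuous_re).mem_nhds hz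
    have e2 : ∀ᶠ w in 𝓝 z, w ≠ 1 := eventually_ne_nhds hz1
    have e3 : ∀ᶠ w in 𝓝 z, riemannZeta w ≠ 0 :=
      (differentiableAt_riemannZeta hz1).continuousAt.eventually_ne hζ
    filter_upwards [e1, e2, e3] with w hw hw1 hwζ
    simp only [hg, hhm]
    rw [eq_div_iff hwζ, iterate_eq_zeta_mul m hw hw1 hwζ]
    ring
  have hgz : g z = hm z / riemannZeta z :=
    Filter.Eventually.self_of_nhds (p := fun w ↦ g w = hm w / riemannZeta w) hU
  have hgz' : deriv g z = deriv (fun w ↦ hm w / riemannZeta w) z :=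
    Filter.EventuallyEq.deriv_eq hU
  have hh_an : AnalyticAt ℂ hm z := analyticAt_iterate m hz hz1
  have hζ_diff : DifferentiableAt ℂ riemannZeta z := differentiableAt_riemannZeta hz1
  have hdiv : deriv (fun w ↦ hm w / riemannZeta w) z =
      (deriv hm z * riemannZeta z - hm z * deriv riemannZeta z) / riemannZeta z ^ 2 :=
    deriv_div hh_an.differentiableAt hζ_diff hζ
  have hgne : g z ≠ 0 := div_ne_zero hfm hξ
  have hhz : hm z ≠ 0 := by
    intro h0
    rw [hgz, h0, zero_div] at hgne
    exact hgne rfl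
  have hgd : deriv g z = (deriv (iteratedDeriv m riemannXi) z * riemannXi z -
      iteratedDeriv m riemannXi z * deriv riemannXi z) / riemannXi z ^ 2 :=
    deriv_div (differentiable_iter m z) (differentiable_riemannXi z) hξ
  rw [deriv_iter] at hgd
  have hlhs : iteratedDeriv (m + 1) riemannXi z / iteratedDeriv m riemannXi z -
      deriv riemannXi z / riemannXi z = deriv g z / g z := by
    rw [hgd, hg]
    field_simp
  rw [hlhs]
  show deriv g z / g z = deriv hm z / hm z - deriv riemannZeta z / riemannZeta z
  rw [hgz', hdiv, hgz]
  field_simp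

/-- Points of the disc `|z − (2 + iT)| ≤ r`: `|Re z − 2| ≤ r` and `|Im z − T| ≤ r`. [folklore] -/
private theorem mem_disc_bounds {T r : ℝ} {z : ℂ} (hz : z ∈ closedBall ((2 : ℂ) + T * I) r) :
    |z.re - 2| ≤ r ∧ |z.im - T| ≤ r := by
  rw [mem_closedBall, dist_eq_norm] at hz
  have h1 := abs_re_le_norm (z - (2 + T * I))
  have h2 := abs_im_le_norm (z - (2 + T * I))
  have e1 : (z - (2 + T * I)).re = z.re - 2 := by simp
  have e2 : (z - (2 + T * I)).im = z.im - T := by simp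
  rw [e1] at h1
  rw [e2] at h2
  exact ⟨h1.trans hz, h2.trans hz⟩

/-- **`|h_j| ≤ (δ⁻¹ + 7 + log(T+6)/2)^j · 40(T+4)` on `|z − (2+iT)| ≤ 7/4 − jδ`** for `T ≥ 4`, `δ > 0`,
`jδ ≤ 1/4` (Cauchy steps of radius `δ`; `|G| ≤ 7 + log(T+6)/2`, `|ζ| ≤ 40(T+4)` on the big disc).
[cite: Conrey1983, Lemma 2 proof (p. 52)] -/
theorem norm_iterate_le {T δ : ℝ} (hT : 4 ≤ T) (hδ : 0 < δ) (j : ℕ) (hj : j * δ ≤ 1 / 4) {z : ℂ}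
    (hz : z ∈ closedBall ((2 : ℂ) + T * I) (7 / 4 - j * δ)) :
    ‖((fun (φ : ℂ → ℂ) (w : ℂ) ↦ deriv φ w + (w⁻¹ + (w - 1)⁻¹ + logDeriv Gammaℝ w) * φ w)^[j] riemannZeta) z‖ ≤ (δ⁻¹ + 7 + Real.log (T + 6) / 2) ^ j * (40 * (T + 4)) := by
  have hT' : 2 ≤ |T| := by rw [abs_of_nonneg (by linarith)]; linarith
  have hTabs : |T| = T := abs_of_nonneg (by linarith)
  have hL0 : 0 ≤ Real.log (T + 6) := Real.log_nonneg (by linarith)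
  induction j generalizing z with
  | zero =>
    simp only [Function.iterate_zero, id_eq, pow_zero, one_mul]
    have hz' : z ∈ closedBall ((2 : ℂ) + T * I) (39 / 20) :=
      closedBall_subset_closedBall (by norm_num) hz
    have := norm_riemannZeta_le_of_mem_jensenDisc hT' hz'
    rwa [hTabs] at this
  | succ j ih =>
    have hj' : (j : ℝ) * δ ≤ 1 / 4 := by
      have : (j : ℝ) * δ ≤ (j + 1 : ℕ) * δ := by push_cast; nlinarith
      exact this.trans hj
    rw [Function.iterate_succ_apply']
    set hj_fun : ℂ → ℂ := (fun (φ : ℂ → ℂ) (w : ℂ) ↦ deriv φ w + (w⁻¹ + (w - 1)⁻¹ + logDeriv Gammaℝ w) * φ w)^[j] riemannZeta with hhj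
    set Mj : ℝ := (δ⁻¹ + 7 + Real.log (T + 6) / 2) ^ j * (40 * (T + 4)) with hMj
    have hMj0 : 0 ≤ Mj := by positivity
    -- the small disc around `z` lies in the previous disc
    have hsub : closedBall z δ ⊆ closedBall ((2 : ℂ) + T * I) (7 / 4 - j * δ) := by
      intro w hw
      rw [mem_closedBall] at hw hz ⊢
      have := dist_triangle w z ((2 : ℂ) + T * I)
      push_cast at hz
      linarith
    have hbig : closedBall ((2 : ℂ) + T * I) (7 / 4 - j * δ) ⊆ closedBall ((2 : ℂ) + T * I) (7 / 4) :=
      closedBall_subset_closedBall (by nlinarith)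
    have han : ∀ w ∈ closedBall ((2 : ℂ) + T * I) (7 / 4 - j * δ), AnalyticAt ℂ hj_fun w := by
      intro w hw
      obtain ⟨hre, him⟩ := mem_disc_bounds (hbig hw)
      have hre' := abs_le.1 hre
      have him' := abs_le.1 him
      refine analyticAt_iterate j (by linarith) fun h1 ↦ ?_
      have := congrArg Complex.im h1
      simp at this
      linarith
    have hdiff : DifferentiableOn ℂ hj_fun (closedBall ((2 : ℂ) + T * I) (7 / 4 - j * δ)) :=
      fun w hw ↦ (han w hw).differentiableAt.differentiableWithinAt
    have hdc : DiffContOnCl ℂ hj_fun (ball z δ) := hdiff.diffContOnCl_ball hsub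
    have hC : ∀ w ∈ sphere z δ, ‖hj_fun w‖ ≤ Mj := fun w hw ↦
      ih hj' (hsub (sphere_subset_closedBall hw))
    have hder := Complex.norm_deriv_le_of_forall_mem_sphere_norm_le hδ hdc hC
    have hz' : z ∈ closedBall ((2 : ℂ) + T * I) (7 / 4) := by
      refine hbig ?_
      rw [mem_closedBall] at hz ⊢
      push_cast at hz
      nlinarith
    have hG := XiDeriv2Arg.norm_G_le_disc hT hz'
    have hself : ‖hj_fun z‖ ≤ Mj := ih hj' (by
      rw [mem_closedBall] at hz ⊢; push_cast at hz; nlinarith)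
    have hG0 : 0 ≤ 7 + Real.log (T + 6) / 2 := by linarith
    calc ‖deriv hj_fun z + (z⁻¹ + (z - 1)⁻¹ + logDeriv Gammaℝ z) * hj_fun z‖
        ≤ ‖deriv hj_fun z‖ + ‖z⁻¹ + (z - 1)⁻¹ + logDeriv Gammaℝ z‖ * ‖hj_fun z‖ := by
          rw [← norm_mul]; exact norm_add_le _ _
      _ ≤ Mj / δ + (7 + Real.log (T + 6) / 2) * Mj :=
          add_le_add hder (mul_le_mul hG hself (norm_nonneg _) hG0)
      _ = (δ⁻¹ + 7 + Real.log (T + 6) / 2) ^ (j + 1) * (40 * (T + 4)) := by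
          rw [hMj, pow_succ]; ring

/-! ## §6. A polynomial lower bound for `Re F_j(2+iT)`, uniformly in `j < m` -/

/-- **`Re ξ^{(j+1)}/ξ^{(j)}(2 + iT) ≥ (3/2)/(T + 2 + A)⁴` for `T ≥ 0`**, for some `A ≥ 0` depending on `j`
(the quantitative Jensen-circle sign lemma for `Ξ^{(j)}` and one of its zeros `a`, `A = ‖a‖`, at the point
`w = T − 3i/2`: `Re F_j(2+iT) = Im (Ξ^{(j+1)}/Ξ^{(j)})(w)`). [cite: Conrey1983, Lemma 2 proof (p. 52)] -/
theorem re_logDeriv_iter_two_add_ge (j : ℕ) :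
    ∃ A : ℝ, 0 ≤ A ∧ ∀ T : ℝ, 0 ≤ T → (3 / 2) / (T + 2 + A) ^ 4 ≤
      (iteratedDeriv (j + 1) riemannXi (2 + T * I) / iteratedDeriv j riemannXi (2 + T * I)).re := by
  obtain ⟨a, ha⟩ := exists_iteratedDeriv_riemannXiUpper_eq_zero j
  obtain ⟨ρ, C, hρ0, hρ, hgr⟩ := exists_growth_riemannXiUpper
  obtain ⟨ρ', C', hρ'0, hρ', hgr'⟩ :=
    exists_growth_iteratedDeriv XiDerivStrip.differentiable_xiUpper hρ0 hρ hgr j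
  set f : ℂ → ℂ := iteratedDeriv j riemannXiUpper with hf
  have hfd : Differentiable ℂ f :=
    differentiable_iteratedDeriv_of_entire XiDerivStrip.differentiable_xiUpper j
  have hreal : ∀ x : ℝ, (f x).im = 0 :=
    im_iteratedDeriv_ofReal XiDerivStrip.differentiable_xiUpper im_riemannXiUpper_ofReal_holds j
  have haim : |a.im| < 1 / 2 := abs_im_lt_half_of_iteratedDeriv_riemannXiUpper_eq_zero j ha
  refine ⟨‖a‖, norm_nonneg _, fun T hT ↦ ?_⟩
  set w : ℂ := (T : ℂ) - 3 / 2 * I with hw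
  have hsz : 1 / 2 + I * w = 2 + T * I := by
    rw [hw]; ring_nf; rw [I_sq]; ring
  have hwim : w.im = -(3 / 2) := by simp [hw]
  have hwre : w.re = T := by simp [hw]
  have hwim_ne : w.im ≠ 0 := by rw [hwim]; norm_num
  have hout : ∀ b, f b = 0 → |b.im| < ‖w - b.re‖ := by
    intro b hb
    have h1 := abs_im_lt_half_of_iteratedDeriv_riemannXiUpper_eq_zero j hb
    have h2 : |(w - (b.re : ℂ)).im| ≤ ‖w - (b.re : ℂ)‖ := Complex.abs_im_le_norm _
    have h3 : (w - (b.re : ℂ)).im = w.im := by simp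
    rw [h3, hwim] at h2
    norm_num at h2
    linarith
  have hq := XiDeriv2Arg.im_mul_im_logDeriv_le hfd hρ'0 hρ' hgr' hreal ha hwim_ne hout
  -- bounds on the pair term of `a`
  have hnum : 2 ≤ ‖w - a.re‖ ^ 2 - a.im ^ 2 := by
    have h2 : |(w - (a.re : ℂ)).im| ≤ ‖w - (a.re : ℂ)‖ := Complex.abs_im_le_norm _
    have h3 : (w - (a.re : ℂ)).im = w.im := by simp
    rw [h3, hwim] at h2
    norm_num at h2
    have h4 : a.im ^ 2 < (1 / 2) ^ 2 := by
      have := abs_lt.1 haim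
      nlinarith
    nlinarith [norm_nonneg (w - (a.re : ℂ))]
  have hwn : ‖w‖ ≤ T + 3 / 2 := by
    calc ‖w‖ ≤ ‖(T : ℂ)‖ + ‖(3 / 2 : ℂ) * I‖ := norm_sub_le _ _
      _ = T + 3 / 2 := by
          rw [Complex.norm_real, Real.norm_eq_abs, abs_of_nonneg hT, norm_mul, Complex.norm_I, mul_one]
          have : ‖(3 / 2 : ℂ)‖ = 3 / 2 := by
            rw [show (3 / 2 : ℂ) = ((3 / 2 : ℝ) : ℂ) by push_cast; ring, Complex.norm_real]
            norm_num
          rw [this]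
  have hden1 : ‖w - a‖ ≤ T + 2 + ‖a‖ := by
    have := norm_sub_le w a; linarith
  have hden2 : ‖w - conj a‖ ≤ T + 2 + ‖a‖ := by
    have := norm_sub_le w (conj a); rw [Complex.norm_conj] at this; linarith
  have hS : 0 < T + 2 + ‖a‖ := by positivity
  -- `f w ≠ 0` so the denominators are positive
  have hwa : 0 < ‖w - a‖ := by
    rw [norm_pos_iff]; intro h0
    have := hout a ha
    rw [sub_eq_zero.1 h0] at this
    have e : a - (a.re : ℂ) = (a.im : ℂ) * I := by apply Complex.ext <;> simp
    rw [e, norm_mul, Complex.norm_I, mul_one, Complex.norm_real, Real.norm_eq_abs] at this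
    exact lt_irrefl _ this
  have hwa' : 0 < ‖w - conj a‖ := by
    rw [norm_pos_iff]; intro h0
    have ha' : f (conj a) = 0 := by
      rw [apply_conj_eq_conj hfd hreal, ha, map_zero]
    have := hout (conj a) ha'
    rw [sub_eq_zero.1 h0] at this
    have e : conj a - ((conj a).re : ℂ) = ((conj a).im : ℂ) * I := by apply Complex.ext <;> simp
    rw [e, norm_mul, Complex.norm_I, mul_one, Complex.norm_real, Real.norm_eq_abs] at this
    exact lt_irrefl _ this
  have hP : 0 < ‖w - a‖ ^ 2 * ‖w - conj a‖ ^ 2 := by positivity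
  -- from `hq`: `(3/2) Im q ≥ (9/4)(num)/(2 den)`
  rw [hwim] at hq
  have hIm : (3 / 4) * ((‖w - a.re‖ ^ 2 - a.im ^ 2) / (‖w - a‖ ^ 2 * ‖w - conj a‖ ^ 2)) ≤
      (deriv f w / f w).im := by
    have e : -((-(3 / 2) : ℝ) ^ 2 * (‖w - ↑a.re‖ ^ 2 - a.im ^ 2) /
        (2 * (‖w - a‖ ^ 2 * ‖w - conj a‖ ^ 2))) =
        -(3 / 2) * ((3 / 4) * ((‖w - a.re‖ ^ 2 - a.im ^ 2) / (‖w - a‖ ^ 2 * ‖w - conj a‖ ^ 2))) := by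
      field_simp
      ring
    rw [e] at hq
    nlinarith
  have hfrac : (3 / 2) / (T + 2 + ‖a‖) ^ 4 ≤
      (3 / 4) * ((‖w - a.re‖ ^ 2 - a.im ^ 2) / (‖w - a‖ ^ 2 * ‖w - conj a‖ ^ 2)) := by
    have hden : ‖w - a‖ ^ 2 * ‖w - conj a‖ ^ 2 ≤ (T + 2 + ‖a‖) ^ 4 := by
      have h1 : ‖w - a‖ ^ 2 ≤ (T + 2 + ‖a‖) ^ 2 := pow_le_pow_left₀ (norm_nonneg _) hden1 2
      have h2 : ‖w - conj a‖ ^ 2 ≤ (T + 2 + ‖a‖) ^ 2 := pow_le_pow_left₀ (norm_nonneg _) hden2 2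
      calc ‖w - a‖ ^ 2 * ‖w - conj a‖ ^ 2 ≤ (T + 2 + ‖a‖) ^ 2 * (T + 2 + ‖a‖) ^ 2 :=
            mul_le_mul h1 h2 (by positivity) (by positivity)
        _ = (T + 2 + ‖a‖) ^ 4 := by ring
    have hS4 : 0 < (T + 2 + ‖a‖) ^ 4 := by positivity
    have h1 : 2 / (T + 2 + ‖a‖) ^ 4 ≤
        (‖w - ↑a.re‖ ^ 2 - a.im ^ 2) / (‖w - a‖ ^ 2 * ‖w - conj a‖ ^ 2) := by
      rw [div_le_div_iff₀ hS4 hP]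
      nlinarith [mul_le_mul_of_nonneg_left hden (by norm_num : (0 : ℝ) ≤ 2),
        mul_le_mul_of_nonneg_right hnum hS4.le]
    calc (3 / 2 : ℝ) / (T + 2 + ‖a‖) ^ 4 = 3 / 4 * (2 / (T + 2 + ‖a‖) ^ 4) := by ring
      _ ≤ _ := mul_le_mul_of_nonneg_left h1 (by norm_num)
  have hquot : deriv f w / f w =
      I * (iteratedDeriv (j + 1) riemannXi (2 + T * I) / iteratedDeriv j riemannXi (2 + T * I)) := by
    rw [hf, ← iteratedDeriv_succ, iteratedDeriv_riemannXiUpper, iteratedDeriv_riemannXiUpper, hsz,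
      pow_succ, mul_assoc, mul_div_mul_left _ _ (pow_ne_zero _ I_ne_zero), mul_div_assoc]
  have := hfrac.trans hIm
  rw [hquot, Complex.I_mul_im] at this
  exact this

/-- Uniform version: for every `m` there is `A ≥ 0` with `Re F_j(2+iT) ≥ (3/2)/(T + 2 + A)⁴` for all
`j < m` and `T ≥ 0`. [cite: Conrey1983, Lemma 2 proof (p. 52)] -/
theorem exists_uniform_lower (m : ℕ) :
    ∃ A : ℝ, 0 ≤ A ∧ ∀ j < m, ∀ T : ℝ, 0 ≤ T → (3 / 2) / (T + 2 + A) ^ 4 ≤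
      (iteratedDeriv (j + 1) riemannXi (2 + T * I) / iteratedDeriv j riemannXi (2 + T * I)).re := by
  induction m with
  | zero => exact ⟨0, le_rfl, fun j hj ↦ absurd hj (Nat.not_lt_zero _)⟩
  | succ m ih =>
    obtain ⟨A, hA, h⟩ := ih
    obtain ⟨A', hA', h'⟩ := re_logDeriv_iter_two_add_ge m
    refine ⟨A + A', by positivity, fun j hj T hT ↦ ?_⟩
    rcases Nat.lt_succ_iff_lt_or_eq.1 hj with hj' | rfl
    · refine le_trans ?_ (h j hj' T hT)
      apply div_le_div_of_nonneg_left (by norm_num) (by positivity)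
      exact pow_le_pow_left₀ (by positivity) (by linarith) 4
    · refine le_trans ?_ (h' T hT)
      apply div_le_div_of_nonneg_left (by norm_num) (by positivity)
      exact pow_le_pow_left₀ (by positivity) (by linarith) 4

/-- **Lower bound at the centre**: if `q ≤ Re F_j(2+iT)` for all `j < m` (`q ≥ 0`), then
`‖ξ^{(m)}(2+iT)‖ ≥ q^m ‖ξ(2+iT)‖`. [cite: Conrey1983, Lemma 2 proof (p. 52)] -/
theorem norm_iter_two_add_ge {m : ℕ} {T q : ℝ} (hq : 0 ≤ q)
    (h : ∀ j < m, q ≤ (iteratedDeriv (j + 1) riemannXi (2 + T * I) /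
      iteratedDeriv j riemannXi (2 + T * I)).re) :
    q ^ m * ‖riemannXi (2 + T * I)‖ ≤ ‖iteratedDeriv m riemannXi (2 + T * I)‖ := by
  induction m with
  | zero => simp
  | succ m ih =>
    have ih' := ih fun j hj ↦ h j (Nat.lt_succ_of_lt hj)
    have hm := h m (Nat.lt_succ_self m)
    have hne : iteratedDeriv m riemannXi (2 + T * I) ≠ 0 :=
      iteratedDeriv_riemannXi_ne_zero_of_one_le_re m (by simp)
    have hF : q ≤ ‖iteratedDeriv (m + 1) riemannXi (2 + T * I) / iteratedDeriv m riemannXi (2 + T * I)‖ :=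
      hm.trans (re_le_norm _)
    rw [norm_div, le_div_iff₀ (norm_pos_iff.2 hne)] at hF
    calc q ^ (m + 1) * ‖riemannXi (2 + T * I)‖ = q * (q ^ m * ‖riemannXi (2 + T * I)‖) := by ring
      _ ≤ q * ‖iteratedDeriv m riemannXi (2 + T * I)‖ := mul_le_mul_of_nonneg_left ih' hq
      _ ≤ ‖iteratedDeriv (m + 1) riemannXi (2 + T * I)‖ := hF

/-! ## §7. Backlund's lemma for `h_m` and the horizontal edge -/

/-- **Backlund's lemma for `h_m` on the top edge**: for `T ≥ 4`, `0 < q ≤ Re F_j(2+iT)` (`j < m`), and no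
zero of `ζ` or `ξ^{(m)}` on `[½, 2] × {T}`, with `M_m(T) = (8(m+1) + 7 + log(T+6)/2)^m · 40(T+4)`:
`|Im ∫_{1/2}^{2} h_m′/h_m(x+iT) dx| ≤ π (log(3 M_m(T)/q^m)/log(13/12) + 1)`
(`|h_m| ≤ M_m(T)` on `|s − (2+iT)| ≤ 13/8`, `|h_m(2+iT)| ≥ q^m/3`). [cite: Conrey1983, Lemma 2 proof (p. 52)] -/
theorem abs_im_integral_logDeriv_iterate_le (m : ℕ) {T q : ℝ} (hT : 4 ≤ T) (hq : 0 < q)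
    (hqF : ∀ j < m, q ≤ (iteratedDeriv (j + 1) riemannXi (2 + T * I) /
      iteratedDeriv j riemannXi (2 + T * I)).re)
    (hζT : ∀ x ∈ Icc (1 / 2 : ℝ) 2, riemannZeta (x + T * I) ≠ 0)
    (hξT : ∀ x ∈ Icc (1 / 2 : ℝ) 2, iteratedDeriv m riemannXi (x + T * I) ≠ 0) :
    |(∫ x in (1 / 2 : ℝ)..2, deriv ((fun (φ : ℂ → ℂ) (w : ℂ) ↦ deriv φ w + (w⁻¹ + (w - 1)⁻¹ + logDeriv Gammaℝ w) * φ w)^[m] riemannZeta) (x + T * I) /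
        ((fun (φ : ℂ → ℂ) (w : ℂ) ↦ deriv φ w + (w⁻¹ + (w - 1)⁻¹ + logDeriv Gammaℝ w) * φ w)^[m] riemannZeta) (x + T * I)).im| ≤
      π * (Real.log (3 * ((8 * (m + 1) + 7 + Real.log (T + 6) / 2) ^ m * (40 * (T + 4))) / q ^ m) /
        Real.log (13 / 12) + 1) := by
  set hm : ℂ → ℂ := (fun (φ : ℂ → ℂ) (w : ℂ) ↦ deriv φ w + (w⁻¹ + (w - 1)⁻¹ + logDeriv Gammaℝ w) * φ w)^[m] riemannZeta with hhm
  set M : ℝ := (8 * (m + 1) + 7 + Real.log (T + 6) / 2) ^ m * (40 * (T + 4)) with hM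
  have hL0 : 0 ≤ Real.log (T + 6) := Real.log_nonneg (by linarith)
  have hM1 : 1 ≤ M := by
    have hm0 : (0 : ℝ) ≤ m := Nat.cast_nonneg _
    have h1 : (1 : ℝ) ≤ (8 * (m + 1) + 7 + Real.log (T + 6) / 2) ^ m :=
      one_le_pow₀ (by linarith)
    have h2 : (1 : ℝ) ≤ 40 * (T + 4) := by linarith
    rw [hM]; nlinarith
  have hqm : 0 < q ^ m := pow_pos hq m
  have hg : ∀ z ∈ closedBall (((2 : ℝ) : ℂ) + T * I) (13 / 8), AnalyticAt ℂ hm z := by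
    intro z hz
    simp only [ofReal_ofNat] at hz
    obtain ⟨hre, him⟩ := mem_disc_bounds hz
    have hre' := abs_le.1 hre
    have him' := abs_le.1 him
    refine analyticAt_iterate m (by linarith) fun h1 ↦ ?_
    have := congrArg Complex.im h1
    simp at this
    linarith
  have hδ : (0 : ℝ) < 1 / (8 * (m + 1)) := by positivity
  have hmδ : (m : ℝ) * (1 / (8 * (m + 1))) ≤ 1 / 4 := by
    rw [← mul_div_assoc, mul_one, div_le_iff₀ (by positivity)]
    have : (m : ℝ) ≤ m + 1 := by linarith
    nlinarith
  have hgM : ∀ z ∈ closedBall (((2 : ℝ) : ℂ) + T * I) (13 / 8), ‖hm z‖ ≤ M := by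
    intro z hz
    simp only [ofReal_ofNat] at hz
    have hz' : z ∈ closedBall ((2 : ℂ) + T * I) (7 / 4 - m * (1 / (8 * (m + 1)))) := by
      refine closedBall_subset_closedBall ?_ hz
      have : (m : ℝ) * (1 / (8 * (m + 1))) ≤ 1 / 8 := by
        rw [← mul_div_assoc, mul_one, div_le_iff₀ (by positivity)]
        have : (m : ℝ) ≤ m + 1 := by linarith
        nlinarith
      linarith
    have h := norm_iterate_le hT hδ m hmδ hz'
    have e : (1 / (8 * ((m : ℝ) + 1)))⁻¹ = 8 * (m + 1) := by
      rw [one_div, inv_inv]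
    rw [e] at h
    simpa [hM] using h
  have hc2 : (2 : ℂ) + T * I ≠ 1 := fun h1 ↦ by
    have := congrArg Complex.re h1; norm_num at this
  have hcenter : hm ((2 : ℝ) + T * I) = riemannZeta (2 + T * I) *
      (iteratedDeriv m riemannXi (2 + T * I) / riemannXi (2 + T * I)) := by
    simp only [ofReal_ofNat, hhm]
    exact iterate_eq_zeta_mul m (by simp) hc2 (riemannZeta_two_add_ne_zero T)
  have hξc : riemannXi (2 + T * I) ≠ 0 := riemannXi_ne_zero_of_one_le_re (by simp)
  have hnorm : q ^ m / 3 ≤ ‖hm ((2 : ℝ) + T * I)‖ := by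
    have h1 := one_third_le_norm_riemannZeta_two_add T
    have h2 := norm_iter_two_add_ge hq.le hqF
    rw [hcenter, norm_mul, norm_div]
    have hξpos : 0 < ‖riemannXi (2 + T * I)‖ := norm_pos_iff.2 hξc
    have h3 : q ^ m ≤ ‖iteratedDeriv m riemannXi (2 + T * I)‖ / ‖riemannXi (2 + T * I)‖ := by
      rw [le_div_iff₀ hξpos]; exact h2
    have h4 := mul_le_mul h1 h3 hqm.le (norm_nonneg _)
    linarith
  have hc : hm ((2 : ℝ) + T * I) ≠ 0 := by
    intro h0; rw [h0, norm_zero] at hnorm; linarith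
  have h0 : ∀ x ∈ Icc (1 / 2 : ℝ) 2, hm (x + T * I) ≠ 0 := by
    intro x hx h0'
    have hx1 : (x : ℂ) + T * I ≠ 1 := fun h1 ↦ by
      have := congrArg Complex.im h1; simp at this; linarith
    have hre : 0 < ((x : ℂ) + T * I).re := by simp; linarith [hx.1]
    have e := iterate_eq_zeta_mul m hre hx1 (hζT x hx)
    simp only [hhm] at h0'
    rw [h0'] at e
    have hξ : riemannXi (x + T * I) ≠ 0 := fun h0'' ↦
      hζT x hx ((riemannXi_eq_zero_iff_holds _).1 h0'').1
    rcases mul_eq_zero.1 e.symm with h' | h'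
    · exact hζT x hx h'
    · exact div_ne_zero (hξT x hx) hξ h'
  have hB := Literature.Analysis.Complex.abs_im_integral_logDeriv_le_backlund (g := hm) (c := 2) (y := T)
    (r := 3 / 2) (R := 13 / 8) (M := M) (a := 1 / 2) (b := 2) (by norm_num) (by norm_num) hM1 hg hgM hc
    (by norm_num) (by norm_num) (by norm_num) h0
  refine hB.trans ?_
  have h1312 : (13 : ℝ) / 8 / (3 / 2) = 13 / 12 := by norm_num
  rw [h1312]
  have hlog : 0 < Real.log (13 / 12) := Real.log_pos (by norm_num)
  have hpos : 0 < ‖hm ((2 : ℝ) + T * I)‖ := by linarith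
  have h1 : Real.log (M / ‖hm ((2 : ℝ) + T * I)‖) ≤ Real.log (3 * M / q ^ m) := by
    apply Real.log_le_log (div_pos (by linarith) hpos)
    rw [show 3 * M / q ^ m = M / (q ^ m / 3) by field_simp]
    exact div_le_div_of_nonneg_left (by linarith) (by positivity) hnorm
  have := div_le_div_of_nonneg_right h1 hlog.le
  nlinarith [Real.pi_pos]

/-- **The horizontal edge**: for `T ≥ 4` with `0 < q ≤ Re F_j(2+iT)` (`j < m`) and no zero of `ζ` or
`ξ^{(m)}` on `[½, 2] × {T}`,
`|Im ∫_{1/2}^{2} F_m(x+iT) dx − Im ∫_{1/2}^{2} ξ′/ξ(x+iT) dx| ≤ π (log(3 M_m(T)/q^m)/log(13/12) + 1) +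
π (log(120(T+4))/log(7/6) + 1)`. [cite: Conrey1983, Lemma 2 proof (p. 52)] -/
theorem abs_horizontal_sub_le (m : ℕ) {T q : ℝ} (hT : 4 ≤ T) (hq : 0 < q)
    (hqF : ∀ j < m, q ≤ (iteratedDeriv (j + 1) riemannXi (2 + T * I) /
      iteratedDeriv j riemannXi (2 + T * I)).re)
    (hζT : ∀ x ∈ Icc (1 / 2 : ℝ) 2, riemannZeta (x + T * I) ≠ 0)
    (hξT : ∀ x ∈ Icc (1 / 2 : ℝ) 2, iteratedDeriv m riemannXi (x + T * I) ≠ 0) :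
    |(∫ x in (1 / 2 : ℝ)..2, iteratedDeriv (m + 1) riemannXi (x + T * I) /
        iteratedDeriv m riemannXi (x + T * I)).im -
      (∫ x in (1 / 2 : ℝ)..2, deriv riemannXi (x + T * I) / riemannXi (x + T * I)).im| ≤
      π * (Real.log (3 * ((8 * (m + 1) + 7 + Real.log (T + 6) / 2) ^ m * (40 * (T + 4))) / q ^ m) /
        Real.log (13 / 12) + 1) + π * (Real.log (120 * (T + 4)) / Real.log (7 / 6) + 1) := by
  set hm : ℂ → ℂ := (fun (φ : ℂ → ℂ) (w : ℂ) ↦ deriv φ w + (w⁻¹ + (w - 1)⁻¹ + logDeriv Gammaℝ w) * φ w)^[m] riemannZeta with hhm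
  set Fm : ℂ → ℂ := fun z ↦ iteratedDeriv (m + 1) riemannXi z / iteratedDeriv m riemannXi z with hFm
  set F : ℂ → ℂ := fun z ↦ deriv riemannXi z / riemannXi z with hF'
  set Lh : ℂ → ℂ := fun z ↦ deriv hm z / hm z with hLh
  set Lζ : ℂ → ℂ := fun z ↦ deriv riemannZeta z / riemannZeta z with hLζ
  have hx1 : ∀ x : ℝ, (x : ℂ) + T * I ≠ 1 := fun x h1 ↦ by
    have := congrArg Complex.im h1; simp at this; linarith
  have hxre : ∀ x ∈ Icc (1 / 2 : ℝ) 2, 0 < ((x : ℂ) + T * I).re := fun x hx ↦ by simp; linarith [hx.1]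
  have hξ : ∀ x ∈ Icc (1 / 2 : ℝ) 2, riemannXi (x + T * I) ≠ 0 := fun x hx h0 ↦
    hζT x hx ((riemannXi_eq_zero_iff_holds _).1 h0).1
  have hpt : ∀ x ∈ Icc (1 / 2 : ℝ) 2, Fm (x + T * I) - F (x + T * I) = Lh (x + T * I) - Lζ (x + T * I) :=
    fun x hx ↦ logDeriv_iter_sub_logDeriv_eq m (hxre x hx) (hx1 x) (hζT x hx) (hξT x hx)
  have hh0 : ∀ x ∈ Icc (1 / 2 : ℝ) 2, hm (x + T * I) ≠ 0 := by
    intro x hx h0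
    have e := iterate_eq_zeta_mul m (hxre x hx) (hx1 x) (hζT x hx)
    simp only [hhm] at h0
    rw [h0] at e
    rcases mul_eq_zero.1 e.symm with h' | h'
    · exact hζT x hx h'
    · exact div_ne_zero (hξT x hx) (hξ x hx) h'
  have i1 : IntervalIntegrable (fun x : ℝ ↦ Fm (x + T * I)) volume (1 / 2) 2 :=
    Literature.Analysis.Complex.intervalIntegrable_of_continuousAt_horizontal (F := Fm) T (by norm_num)
      fun x hx ↦ continuousAt_logDeriv_iter m (hξT x hx)
  have i2 : IntervalIntegrable (fun x : ℝ ↦ F (x + T * I)) volume (1 / 2) 2 :=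
    Literature.Analysis.Complex.intervalIntegrable_of_continuousAt_horizontal (F := F) T (by norm_num)
      fun x hx ↦ continuousAt_logDeriv_riemannXi (hξ x hx)
  have i3 : IntervalIntegrable (fun x : ℝ ↦ Lh (x + T * I)) volume (1 / 2) 2 :=
    Literature.Analysis.Complex.intervalIntegrable_of_continuousAt_horizontal (F := Lh) T (by norm_num)
      fun x hx ↦ by
        have ha := analyticAt_iterate m (hxre x hx) (hx1 x)
        exact ha.deriv.continuousAt.div ha.continuousAt (hh0 x hx)
  have i4 : IntervalIntegrable (fun x : ℝ ↦ Lζ (x + T * I)) volume (1 / 2) 2 :=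
    Literature.Analysis.Complex.intervalIntegrable_of_continuousAt_horizontal (F := Lζ) T (by norm_num)
      fun x hx ↦ continuousAt_logDeriv_riemannZeta (hx1 x) (hζT x hx)
  have hint : (∫ x in (1 / 2 : ℝ)..2, Fm (x + T * I)) - (∫ x in (1 / 2 : ℝ)..2, F (x + T * I)) =
      (∫ x in (1 / 2 : ℝ)..2, Lh (x + T * I)) - ∫ x in (1 / 2 : ℝ)..2, Lζ (x + T * I) := by
    rw [← intervalIntegral.integral_sub i1 i2, ← intervalIntegral.integral_sub i3 i4]
    refine intervalIntegral.integral_congr fun x hx ↦ ?_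
    rw [uIcc_of_le (by norm_num)] at hx
    exact hpt x hx
  have hB1 := abs_im_integral_logDeriv_iterate_le m hT hq hqF hζT hξT
  have hB2 := abs_im_integral_logDeriv_riemannZeta_horizontal_le (T := T) (by linarith) hζT
  have key : (∫ x in (1 / 2 : ℝ)..2, Fm (x + T * I)).im - (∫ x in (1 / 2 : ℝ)..2, F (x + T * I)).im =
      (∫ x in (1 / 2 : ℝ)..2, Lh (x + T * I)).im - (∫ x in (1 / 2 : ℝ)..2, Lζ (x + T * I)).im := by
    rw [← sub_im, hint, sub_im]
  show |(∫ x in (1 / 2 : ℝ)..2, Fm (x + T * I)).im - (∫ x in (1 / 2 : ℝ)..2, F (x + T * I)).im| ≤ _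
  rw [key]
  exact (abs_sub _ _).trans (add_le_add hB1 hB2)

/-! ## §8. `|N^{(m)}(T) − N(T)|` off the ordinates -/

/-- **Conrey's Lemma 2 for `ξ^{(m)}`, explicit form off the ordinates.** For `T ≥ 4` with
`0 < q ≤ Re F_j(2+iT)` (`j < m`), `T` not the ordinate of a zero of `ζ` nor of `ξ^{(m)}`, and `c_m` the
multiplicity of `ξ^{(m)}` at `½`:
`|N^{(m)}(T) − N(T)| ≤ m + c_m/2 + 2 + log(3 M_m(T)/q^m)/log(13/12) + log(120(T+4))/log(7/6)`.
[cite: Conrey1983, Lemma 2 (p. 52)] -/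
theorem abs_sub_le_of_not_ordinate (m : ℕ) {T q : ℝ} (hT : 4 ≤ T) (hq : 0 < q)
    (hqF : ∀ j < m, q ≤ (iteratedDeriv (j + 1) riemannXi (2 + T * I) /
      iteratedDeriv j riemannXi (2 + T * I)).re)
    (hζ : ∀ ρ : ℂ, riemannZeta ρ = 0 → ρ.im ≠ T)
    (hξ' : ∀ ρ : ℂ, iteratedDeriv m riemannXi ρ = 0 → ρ.im ≠ T) :
    |(xiDerivZeroCount m T : ℝ) - zetaZeroCount T| ≤
      m + (analyticOrderAt (iteratedDeriv m riemannXi) (1 / 2)).toNat / 2 + 2 +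
        Real.log (3 * ((8 * (m + 1) + 7 + Real.log (T + 6) / 2) ^ m * (40 * (T + 4))) / q ^ m) /
          Real.log (13 / 12) + Real.log (120 * (T + 4)) / Real.log (7 / 6) := by
  have hT0 : 0 < T := by linarith
  have hqm := quarter_path_eq m hT0 hξ'
  have hq0 := XiDerivArg.quarter_path_eq_xi hT0 hζ
  have hv := abs_vertical_sub_le m hT0.le
  simp only [iteratedDeriv_one, iteratedDeriv_zero] at hv
  have hh := abs_horizontal_sub_le m hT hq hqF (fun x _ h0 ↦ hζ _ h0 (by simp))
    (fun x _ h0 ↦ hξ' _ h0 (by simp))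
  set Am : ℝ := ∫ y in (0 : ℝ)..T, (iteratedDeriv (m + 1) riemannXi (2 + y * I) /
    iteratedDeriv m riemannXi (2 + y * I)).re
  set Bm : ℝ := (∫ x in (1 / 2 : ℝ)..2,
    iteratedDeriv (m + 1) riemannXi (x + T * I) / iteratedDeriv m riemannXi (x + T * I)).im
  set A : ℝ := ∫ y in (0 : ℝ)..T, (deriv riemannXi (2 + y * I) / riemannXi (2 + y * I)).re
  set B : ℝ := (∫ x in (1 / 2 : ℝ)..2, deriv riemannXi (x + T * I) / riemannXi (x + T * I)).im
  set c : ℝ := ((analyticOrderAt (iteratedDeriv m riemannXi) (1 / 2)).toNat : ℝ)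
  set L : ℝ := Real.log (3 * ((8 * (m + 1) + 7 + Real.log (T + 6) / 2) ^ m * (40 * (T + 4))) / q ^ m)
  set L' : ℝ := Real.log (120 * (T + 4))
  set l : ℝ := Real.log (13 / 12)
  set l' : ℝ := Real.log (7 / 6)
  have hπ := Real.pi_pos
  have hc0 : 0 ≤ c := Nat.cast_nonneg _
  have hid : π * ((xiDerivZeroCount m T : ℝ) - zetaZeroCount T) = (Am - A) - (Bm - B) - π / 2 * c := by
    linarith
  have hv' := abs_le.1 hv
  have hh' := abs_le.1 hh
  rw [abs_le]
  constructor
  · have key : π * (-(m + c / 2 + 2 + L / l + L' / l')) ≤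
        π * ((xiDerivZeroCount m T : ℝ) - zetaZeroCount T) := by
      rw [hid]
      have e : π * (-(m + c / 2 + 2 + L / l + L' / l')) =
          -(m * π) - (π * (L / l + 1) + π * (L' / l' + 1)) - π / 2 * c := by ring
      rw [e]
      linarith
    exact le_of_mul_le_mul_left key hπ
  · have key : π * ((xiDerivZeroCount m T : ℝ) - zetaZeroCount T) ≤
        π * (m + c / 2 + 2 + L / l + L' / l') := by
      rw [hid]
      have e : π * (m + c / 2 + 2 + L / l + L' / l') =
          m * π + (π * (L / l + 1) + π * (L' / l' + 1)) + π / 2 * c := by ring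
      rw [e]
      nlinarith
    exact le_of_mul_le_mul_left key hπ

/-- The explicit bound is `≤ (m + c_m + 62 + 117 m) log T` for `T ≥ A + 16(m+1) + 45` and
`q = (3/2)/(T+2+A)⁴`. [folklore] -/
private theorem explicit_bound_le (m : ℕ) {T A c : ℝ} (hA : 0 ≤ A) (hc : 0 ≤ c)
    (hT : A + 16 * (m + 1) + 45 ≤ T) :
    m + c / 2 + 2 +
        Real.log (3 * ((8 * (m + 1) + 7 + Real.log (T + 6) / 2) ^ m * (40 * (T + 4))) /
          ((3 / 2) / (T + 2 + A) ^ 4) ^ m) / Real.log (13 / 12) +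
          Real.log (120 * (T + 4)) / Real.log (7 / 6) ≤
      (m + c + 62 + 117 * m) * Real.log T := by
  have hm0 : (0 : ℝ) ≤ m := Nat.cast_nonneg _
  have hT45 : 45 ≤ T := by nlinarith
  have hT1 : 1 < T := by linarith
  have hlogT : 1 ≤ Real.log T := by
    rw [Real.le_log_iff_exp_le (by linarith)]
    have := Real.exp_one_lt_d9
    linarith
  have hL6 : Real.log (T + 6) ≤ T + 5 := (Real.log_le_sub_one_of_pos (by linarith)).trans (by linarith)
  have hL60 : 0 ≤ Real.log (T + 6) := Real.log_nonneg (by linarith)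
  -- the base of `M_m` is `≤ T`
  have hbase : 8 * (m + 1) + 7 + Real.log (T + 6) / 2 ≤ T := by nlinarith
  have hbase0 : 0 ≤ 8 * (m + 1) + 7 + Real.log (T + 6) / 2 := by positivity
  have h40 : 40 * (T + 4) ≤ T ^ 2 := by nlinarith
  have hS : T + 2 + A ≤ T ^ 2 := by nlinarith
  have hS0 : 0 < T + 2 + A := by linarith
  have hqinv : ((3 / 2) / (T + 2 + A) ^ 4)⁻¹ ≤ T ^ 8 := by
    rw [inv_div, div_le_iff₀ (by norm_num)]
    have h1 : (T + 2 + A) ^ 4 ≤ (T ^ 2) ^ 4 := pow_le_pow_left₀ hS0.le hS 4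
    nlinarith [pow_nonneg (by linarith : (0 : ℝ) ≤ T) 8]
  have hq0 : 0 < (3 / 2) / (T + 2 + A) ^ 4 := by positivity
  -- `3 M_m / q^m ≤ T^(3 + 9m)`
  have hX : 3 * ((8 * (m + 1) + 7 + Real.log (T + 6) / 2) ^ m * (40 * (T + 4))) /
      ((3 / 2) / (T + 2 + A) ^ 4) ^ m ≤ T ^ (3 + 9 * m) := by
    rw [div_eq_mul_inv, ← inv_pow]
    have h1 : (8 * (m + 1) + 7 + Real.log (T + 6) / 2) ^ m ≤ T ^ m := pow_le_pow_left₀ hbase0 hbase m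
    have h2 : (((3 / 2) / (T + 2 + A) ^ 4)⁻¹) ^ m ≤ (T ^ 8) ^ m :=
      pow_le_pow_left₀ (inv_nonneg.2 hq0.le) hqinv m
    have h3 : (3 : ℝ) ≤ T := by linarith
    calc 3 * ((8 * (m + 1) + 7 + Real.log (T + 6) / 2) ^ m * (40 * (T + 4))) *
          (((3 / 2) / (T + 2 + A) ^ 4)⁻¹) ^ m
        ≤ T * (T ^ m * T ^ 2) * (T ^ 8) ^ m := by
          apply mul_le_mul _ h2 (by positivity) (by positivity)
          exact mul_le_mul h3 (mul_le_mul h1 h40 (by positivity) (by positivity)) (by positivity)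
            (by positivity)
      _ = T ^ (3 + 9 * m) := by rw [← pow_mul]; ring
  have hXpos : 0 < 3 * ((8 * (m + 1) + 7 + Real.log (T + 6) / 2) ^ m * (40 * (T + 4))) /
      ((3 / 2) / (T + 2 + A) ^ 4) ^ m := by positivity
  have hlogX : Real.log (3 * ((8 * (m + 1) + 7 + Real.log (T + 6) / 2) ^ m * (40 * (T + 4))) /
      ((3 / 2) / (T + 2 + A) ^ 4) ^ m) ≤ (3 + 9 * m) * Real.log T := by
    have := Real.log_le_log hXpos hX
    rw [Real.log_pow] at this
    push_cast at this
    exact this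
  have hlogX0 : 0 ≤ Real.log (3 * ((8 * (m + 1) + 7 + Real.log (T + 6) / 2) ^ m * (40 * (T + 4))) /
      ((3 / 2) / (T + 2 + A) ^ 4) ^ m) := by
    apply Real.log_nonneg
    rw [le_div_iff₀ (pow_pos hq0 m)]
    have h1 : ((3 / 2) / (T + 2 + A) ^ 4) ^ m ≤ 1 := by
      apply pow_le_one₀ hq0.le
      rw [div_le_one (by positivity)]
      have : (1 : ℝ) ≤ T + 2 + A := by linarith
      calc (3 / 2 : ℝ) ≤ T + 2 + A := by linarith
        _ ≤ (T + 2 + A) ^ 4 := le_self_pow₀ this (by norm_num)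
    have h2 : (1 : ℝ) ≤ (8 * (m + 1) + 7 + Real.log (T + 6) / 2) ^ m := one_le_pow₀ (by linarith)
    nlinarith
  -- `120 (T+4) ≤ T^3`
  have hY : 120 * (T + 4) ≤ T ^ 3 := by nlinarith
  have hlogY : Real.log (120 * (T + 4)) ≤ 3 * Real.log T := by
    have := Real.log_le_log (by positivity) hY
    rw [Real.log_pow] at this
    push_cast at this
    exact this
  have hlogY0 : 0 ≤ Real.log (120 * (T + 4)) := Real.log_nonneg (by linarith)
  have hl76 : 1 / 7 ≤ Real.log (7 / 6) := by
    have := Real.one_sub_inv_le_log_of_pos (show (0 : ℝ) < 7 / 6 by norm_num)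
    norm_num at this ⊢
    linarith
  have hl1312 : 1 / 13 ≤ Real.log (13 / 12) := by
    have := Real.one_sub_inv_le_log_of_pos (show (0 : ℝ) < 13 / 12 by norm_num)
    norm_num at this ⊢
    linarith
  have hl76pos : 0 < Real.log (7 / 6) := by linarith
  have hl1312pos : 0 < Real.log (13 / 12) := by linarith
  have hdiv1 : Real.log (3 * ((8 * (m + 1) + 7 + Real.log (T + 6) / 2) ^ m * (40 * (T + 4))) /
      ((3 / 2) / (T + 2 + A) ^ 4) ^ m) / Real.log (13 / 12) ≤ 13 * ((3 + 9 * m) * Real.log T) := by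
    rw [div_le_iff₀ hl1312pos]
    nlinarith
  have hdiv2 : Real.log (120 * (T + 4)) / Real.log (7 / 6) ≤ 7 * (3 * Real.log T) := by
    rw [div_le_iff₀ hl76pos]
    nlinarith
  nlinarith

/-- **Conrey 1983, Lemma 2 (counting part), every `m`: `N^{(m)}(T) − N(T) = O_m(log T)`.** For every `m`
there are `C` and `T₀ > 0` with `|N^{(m)}(T) − N(T)| ≤ C log T` for all `T ≥ T₀`, where
`N^{(m)}(T) = xiDerivZeroCount m T` counts the zeros of `ξ^{(m)}` with `0 < Im s ≤ T` and `N(T) = zetaZeroCount T`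
those of `ζ` (both with multiplicity). PROVED by Backlund's argument (argument principle for `ξ^{(m)}` and
`ξ` on `[−1,2] × [−T,T]`, Jensen's formula for `h_m = D^m ζ` on the top edge, Conrey's inequality
`Re ξ^{(j+1)}/ξ^{(j)} > 0` on `Re s = 2`). [cite: Conrey1983, Lemma 2 (p. 52)] -/
theorem exists_abs_xiDerivZeroCount_sub_zetaZeroCount_le_log_all (m : ℕ) :
    ∃ C T₀ : ℝ, 0 < T₀ ∧ ∀ T : ℝ, T₀ ≤ T →
      |(xiDerivZeroCount m T : ℝ) - zetaZeroCount T| ≤ C * Real.log T := by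
  classical
  obtain ⟨A, hA, hqF⟩ := exists_uniform_lower m
  set c : ℝ := ((analyticOrderAt (iteratedDeriv m riemannXi) (1 / 2)).toNat : ℝ) with hc
  have hc0 : 0 ≤ c := Nat.cast_nonneg _
  refine ⟨2 * (m + c + 62 + 117 * m), A + 16 * (m + 1) + 45, by positivity, fun T hT ↦ ?_⟩
  have hm0 : (0 : ℝ) ≤ m := Nat.cast_nonneg _
  have hT45 : 45 ≤ T := by nlinarith
  -- move `T` up to a nearby `T'` past no ordinate of `ζ` or `ξ^{(m)}`
  set Zζ : Set ℂ := {ρ ∈ zetaZeroBox 0 (T + 1) | T < ρ.im} with hZζ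
  set Zξ : Set ℂ := {ρ ∈ xiDerivZeroBox m (T + 1) | T < ρ.im} with hZξ
  have hfinζ : Zζ.Finite := (zetaZeroBox_finite 0 (T + 1)).subset (sep_subset _ _)
  have hfinξ : Zξ.Finite := (XiDerivCritical.xiDerivZeroBox_finite m (T + 1)).subset (sep_subset _ _)
  set Fs : Finset ℝ := insert (T + 1)
    ((hfinζ.toFinset.image Complex.im) ∪ (hfinξ.toFinset.image Complex.im)) with hFs
  have hne : Fs.Nonempty := Finset.insert_nonempty _ _
  set mn : ℝ := Fs.min' hne with hmn
  have hmle : mn ≤ T + 1 := Finset.min'_le _ _ (Finset.mem_insert_self _ _)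
  have hmgt : T < mn := by
    have hmem := Finset.min'_mem Fs hne
    rw [← hmn] at hmem
    rcases Finset.mem_insert.1 hmem with h | h
    · linarith
    · rcases Finset.mem_union.1 h with h | h
      · obtain ⟨ρ, hρ, hρm⟩ := Finset.mem_image.1 h
        rw [Set.Finite.mem_toFinset] at hρ
        rw [← hρm]; exact hρ.2
      · obtain ⟨ρ, hρ, hρm⟩ := Finset.mem_image.1 h
        rw [Set.Finite.mem_toFinset] at hρ
        rw [← hρm]; exact hρ.2
  set T' : ℝ := (T + mn) / 2 with hT'
  have hTT' : T < T' := by rw [hT']; linarith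
  have hT'1 : T' < T + 1 := by rw [hT']; linarith
  have hT'm : T' < mn := by rw [hT']; linarith
  have hnoζ : ∀ ρ : ℂ, riemannZeta ρ = 0 → ¬(T < ρ.im ∧ ρ.im ≤ T') := by
    rintro ρ hζ0 ⟨h1, h2⟩
    have him : ρ.im ≠ 0 := by intro h0; rw [h0] at h1; linarith
    have hst := re_mem_Ioo_of_riemannZeta_eq_zero_of_im_ne_zero hζ0 him
    have hρZ : ρ ∈ Zζ := ⟨⟨hζ0, hst.1.le, hst.2.le, by linarith, by linarith⟩, h1⟩
    have hρF : ρ.im ∈ Fs := Finset.mem_insert_of_mem (Finset.mem_union_left _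
      (Finset.mem_image.2 ⟨ρ, (Set.Finite.mem_toFinset hfinζ).2 hρZ, rfl⟩))
    have := Finset.min'_le Fs _ hρF
    rw [← hmn] at this
    linarith
  have hnoξ : ∀ ρ : ℂ, iteratedDeriv m riemannXi ρ = 0 → ¬(T < ρ.im ∧ ρ.im ≤ T') := by
    rintro ρ h0 ⟨h1, h2⟩
    have hρZ : ρ ∈ Zξ := ⟨⟨h0, by linarith, by linarith⟩, h1⟩
    have hρF : ρ.im ∈ Fs := Finset.mem_insert_of_mem (Finset.mem_union_right _
      (Finset.mem_image.2 ⟨ρ, (Set.Finite.mem_toFinset hfinξ).2 hρZ, rfl⟩))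
    have := Finset.min'_le Fs _ hρF
    rw [← hmn] at this
    linarith
  have hζ' : ∀ ρ : ℂ, riemannZeta ρ = 0 → ρ.im ≠ T' := fun ρ h0 he ↦
    hnoζ ρ h0 ⟨by rw [he]; exact hTT', he.le⟩
  have hξ'' : ∀ ρ : ℂ, iteratedDeriv m riemannXi ρ = 0 → ρ.im ≠ T' := fun ρ h0 he ↦
    hnoξ ρ h0 ⟨by rw [he]; exact hTT', he.le⟩
  have hN : zetaZeroCount T' = zetaZeroCount T := zetaZeroCount_eq_of_no_ordinate hTT'.le hnoζ
  have hNm : xiDerivZeroCount m T' = xiDerivZeroCount m T := by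
    have hbox : xiDerivZeroBox m T' = xiDerivZeroBox m T := by
      ext ρ
      simp only [xiDerivZeroBox, mem_setOf_eq]
      constructor
      · rintro ⟨h0, h1, h2⟩
        exact ⟨h0, h1, le_of_not_gt fun hlt ↦ hnoξ ρ h0 ⟨hlt, h2⟩⟩
      · rintro ⟨h0, h1, h2⟩
        exact ⟨h0, h1, h2.trans hTT'.le⟩
    unfold xiDerivZeroCount
    rw [hbox]
  have hT'4 : 4 ≤ T' := by linarith
  have hq0 : 0 < (3 / 2) / (T' + 2 + A) ^ 4 := by
    have : 0 < T' + 2 + A := by linarith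
    positivity
  have hb := abs_sub_le_of_not_ordinate m hT'4 hq0 (fun j hj ↦ hqF j hj T' (by linarith)) hζ' hξ''
  rw [hN, hNm] at hb
  have he := explicit_bound_le m hA hc0 (show A + 16 * (m + 1) + 45 ≤ T' by linarith)
  refine hb.trans (he.trans ?_)
  -- `log T' ≤ log (T + 1) ≤ 2 log T`
  have hK : 0 ≤ (m + c + 62 + 117 * m : ℝ) := by positivity
  have hlog : Real.log T' ≤ 2 * Real.log T := by
    have hsq : T' ≤ T ^ 2 := by nlinarith
    calc Real.log T' ≤ Real.log (T ^ 2) := Real.log_le_log (by linarith) hsq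
      _ = 2 * Real.log T := by rw [Real.log_pow]; push_cast; ring
  nlinarith

end XiDerivMArg

/-! ## §9. The theorems, for every `m` -/

/-- **Conrey 1983, Lemma 2 (every `m`): `N^{(m)}(T) − N(T) = O_m(log T)`.** [cite: Conrey1983, Lemma 2 (p. 52)] -/
theorem exists_abs_xiDerivZeroCount_sub_zetaZeroCount_le_log_all (m : ℕ) :
    ∃ C T₀ : ℝ, 0 < T₀ ∧ ∀ T : ℝ, T₀ ≤ T →
      |(xiDerivZeroCount m T : ℝ) - zetaZeroCount T| ≤ C * Real.log T :=
  XiDerivMArg.exists_abs_xiDerivZeroCount_sub_zetaZeroCount_le_log_all m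

/-- **Conrey 1983, Lemma 2, printed form, every `m`**: `N^{(m)}(T) = (T/2π) log(T/2π) − T/2π + O_m(log T)`.
[cite: Conrey1983, Lemma 2 (p. 52)] -/
theorem xiDerivZeroCount_riemann_von_mangoldt (m : ℕ) :
    (fun T : ℝ ↦ (xiDerivZeroCount m T : ℝ) - (T / (2 * π) * Real.log (T / (2 * π)) - T / (2 * π)))
      =O[atTop] Real.log := by
  obtain ⟨C, T₀, hT₀, h⟩ := exists_abs_xiDerivZeroCount_sub_zetaZeroCount_le_log_all m
  have h1 : (fun T : ℝ ↦ (xiDerivZeroCount m T : ℝ) - zetaZeroCount T) =O[atTop] Real.log := by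
    refine Asymptotics.IsBigO.of_bound C ?_
    filter_upwards [eventually_ge_atTop T₀, eventually_ge_atTop (1 : ℝ)] with T hT hT1
    rw [Real.norm_eq_abs, Real.norm_eq_abs, abs_of_nonneg (Real.log_nonneg hT1)]
    exact h T hT
  have h2 : (fun T : ℝ ↦ (zetaZeroCount T : ℝ) - (T / (2 * π) * Real.log (T / (2 * π)) - T / (2 * π)))
      =O[atTop] Real.log := riemann_von_mangoldt_holds
  refine (h1.add h2).congr_left fun T ↦ ?_
  ring

/-- **`N^{(m)}(T) ∼ N(T)`**: `N^{(m)}(T)/N(T) → 1`, for every `m`. [cite: Conrey1983, Lemma 2 (p. 52)] -/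
theorem tendsto_xiDerivZeroCount_div_zetaZeroCount_all (m : ℕ) :
    Tendsto (fun T : ℝ ↦ (xiDerivZeroCount m T : ℝ) / zetaZeroCount T) atTop (𝓝 1) := by
  obtain ⟨C, T₀, hT₀, hC⟩ := exists_abs_xiDerivZeroCount_sub_zetaZeroCount_le_log_all m
  have hmain := AlpogeFurman2026.eventually_zetaZeroCount_near_main (1 / 2) (by norm_num)
  have hlow : Tendsto (fun T : ℝ ↦ 1 - 4 * Real.pi * |C| * T⁻¹) atTop (𝓝 1) := by
    have := (tendsto_inv_atTop_zero.const_mul (4 * Real.pi * |C|)).const_sub 1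
    simpa using this
  have hhigh : Tendsto (fun T : ℝ ↦ 1 + 4 * Real.pi * |C| * T⁻¹) atTop (𝓝 1) := by
    have := (tendsto_inv_atTop_zero.const_mul (4 * Real.pi * |C|)).const_add 1
    simpa using this
  refine tendsto_of_tendsto_of_tendsto_of_le_of_le' hlow hhigh ?_ ?_
  all_goals
    filter_upwards [eventually_ge_atTop T₀, hmain, eventually_gt_atTop (1 : ℝ)] with T hT hN hT1
    have hπ := Real.pi_pos
    have hL : 0 < Real.log T := Real.log_pos hT1
    have hM : 0 < T / (2 * Real.pi) * Real.log T := by positivity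
    have hNpos : 0 < (zetaZeroCount T : ℝ) := by linarith [hN.1]
    have hb := hC T hT
    have hb' : |(xiDerivZeroCount m T : ℝ) - zetaZeroCount T| ≤ |C| * Real.log T :=
      hb.trans (mul_le_mul_of_nonneg_right (le_abs_self C) hL.le)
    have hq : |(xiDerivZeroCount m T : ℝ) / zetaZeroCount T - 1| ≤ 4 * Real.pi * |C| * T⁻¹ := by
      rw [show (xiDerivZeroCount m T : ℝ) / zetaZeroCount T - 1 =
        ((xiDerivZeroCount m T : ℝ) - zetaZeroCount T) / zetaZeroCount T by field_simp,
        abs_div, abs_of_pos hNpos, div_le_iff₀ hNpos]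
      have hN2 : (1 - 1 / 2) * (T / (2 * Real.pi) * Real.log T) ≤ zetaZeroCount T := hN.1
      calc |(xiDerivZeroCount m T : ℝ) - zetaZeroCount T| ≤ |C| * Real.log T := hb'
        _ = 4 * Real.pi * |C| * T⁻¹ * ((1 - 1 / 2) * (T / (2 * Real.pi) * Real.log T)) := by
          field_simp
          ring
        _ ≤ 4 * Real.pi * |C| * T⁻¹ * zetaZeroCount T :=
          mul_le_mul_of_nonneg_left hN2 (by positivity)
    have hq' := abs_le.1 hq
  · linarith [hq'.1]
  · linarith [hq'.2]

/-! ## §10. Every simple-critical proportion of `ζ` bounds `κ′_m`: `κ′_m ≥ 2/3` and `κ′_m ≥ 0.6725` for all `m` -/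

/-- **From any cumulative simple-critical proportion of `ζ` to `ξ^{(m)}`**: if for every `ε > 0`, eventually
`(κ − ε) N(T) ≤ N₀ˢ(T)`, then for every `ε > 0`, eventually `(κ − ε) N^{(m)}(T) ≤ N^{(m)}₀(T)`
(`N₀ˢ ≤ N^{(m)}₀ + m` by `m` Rolle steps, `N^{(m)} = N + O_m(log T)` by Lemma 2).
[cite: Conrey1983, §1 (p. 49) and Lemma 2 (p. 52)] -/
theorem eventually_mul_xiDerivZeroCount_le_of_simpleCritical_all (m : ℕ) {κ : ℝ}
    (h : ∀ ε : ℝ, 0 < ε → ∀ᶠ T : ℝ in atTop, (κ - ε) * (zetaZeroCount T : ℝ) ≤ simpleCriticalZeroCount T)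
    (ε : ℝ) (hε : 0 < ε) :
    ∀ᶠ T : ℝ in atTop, (κ - ε) * (xiDerivZeroCount m T : ℝ) ≤ xiDerivCriticalZeroCount m T := by
  rcases le_or_gt (κ - ε) 0 with hneg | hpos
  · exact Filter.Eventually.of_forall fun T ↦ by
      have h0 : (0 : ℝ) ≤ xiDerivCriticalZeroCount m T := Nat.cast_nonneg _
      have h1 : (0 : ℝ) ≤ xiDerivZeroCount m T := Nat.cast_nonneg _
      nlinarith
  obtain ⟨C, T₀, hT₀, hC⟩ := exists_abs_xiDerivZeroCount_sub_zetaZeroCount_le_log_all m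
  have hA := h (ε / 4) (by positivity)
  have hmain := AlpogeFurman2026.eventually_zetaZeroCount_near_main (1 / 2) (by norm_num)
  have hNlim : Tendsto (fun T : ℝ ↦ (zetaZeroCount T : ℝ)) atTop atTop :=
    tendsto_natCast_atTop_atTop.comp tendsto_zetaZeroCount_atTop_holds
  have hm0 : (0 : ℝ) ≤ m := Nat.cast_nonneg _
  filter_upwards [hA, hmain, eventually_ge_atTop T₀, eventually_gt_atTop (1 : ℝ),
    eventually_ge_atTop (16 * Real.pi * |C| * κ / ε), hNlim.eventually_ge_atTop (4 * m / ε)]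
    with T hAT hN hT hT1 hTC hNε
  have hπ := Real.pi_pos
  have hL : 0 < Real.log T := Real.log_pos hT1
  have hκ : 0 < κ := by linarith
  have hR : (simpleCriticalZeroCount T : ℝ) ≤ (xiDerivCriticalZeroCount m T : ℝ) + m := by
    exact_mod_cast simpleCriticalZeroCount_le_xiDerivCriticalZeroCount_add m T
  have hmN : (m : ℝ) ≤ ε / 4 * (zetaZeroCount T : ℝ) := by
    have := (div_le_iff₀ hε).1 hNε
    linarith
  have hb := hC T hT
  have hNmle : (xiDerivZeroCount m T : ℝ) ≤ zetaZeroCount T + |C| * Real.log T := by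
    have := (abs_le.1 (hb.trans (mul_le_mul_of_nonneg_right (le_abs_self C) hL.le))).2
    linarith
  have hNlow : (1 - 1 / 2) * (T / (2 * Real.pi) * Real.log T) ≤ zetaZeroCount T := hN.1
  have hClog : κ * (|C| * Real.log T) ≤ ε / 4 * (zetaZeroCount T : ℝ) := by
    have h1 : κ * (|C| * Real.log T) ≤ ε / 4 * ((1 - 1 / 2) * (T / (2 * Real.pi) * Real.log T)) := by
      rw [div_le_iff₀ hε] at hTC
      have : κ * |C| ≤ ε / 4 * ((1 - 1 / 2) * (T / (2 * Real.pi))) := by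
        rw [show ε / 4 * ((1 - 1 / 2) * (T / (2 * Real.pi))) = ε * T / (16 * Real.pi) by ring,
          le_div_iff₀ (by positivity)]
        nlinarith
      nlinarith
    exact h1.trans (mul_le_mul_of_nonneg_left hNlow (by positivity))
  calc (κ - ε) * (xiDerivZeroCount m T : ℝ)
      ≤ (κ - ε) * (zetaZeroCount T + |C| * Real.log T) := mul_le_mul_of_nonneg_left hNmle hpos.le
    _ ≤ (κ - ε) * zetaZeroCount T + κ * (|C| * Real.log T) := by
        nlinarith [mul_nonneg (abs_nonneg C) hL.le]
    _ ≤ (κ - ε / 4) * zetaZeroCount T - m := by nlinarith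
    _ ≤ simpleCriticalZeroCount T - m := by linarith
    _ ≤ xiDerivCriticalZeroCount m T := by linarith

/-- **Any cumulative proportion of simple critical zeros of `ζ` bounds every `κ′_m` from below.**
[cite: Conrey1983, §1 (p. 49)] -/
theorem le_xiDerivCriticalLineProportion_of_simpleCritical (m : ℕ) {κ : ℝ}
    (h : ∀ ε : ℝ, 0 < ε → ∀ᶠ T : ℝ in atTop,
      (κ - ε) * (zetaZeroCount T : ℝ) ≤ simpleCriticalZeroCount T) :
    κ ≤ xiDerivCriticalLineProportion m := by
  refine le_of_forall_pos_lt_add fun ε hε ↦ ?_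
  have h' := le_xiDerivCriticalLineProportion_of_eventually_le m
    (eventually_mul_xiDerivZeroCount_le_of_simpleCritical_all m h (ε / 2) (by positivity))
  linarith

/-- **Unconditionally, `κ′_m ≥ 2/3` for every `m`: at least two thirds of the zeros of `ξ^{(m)}` are on the
critical line** ([AF26] Theorem A (i), `⅔` of the zeros of `ζ` are simple and critical, cumulative form,
transferred by `m` Rolle steps and Lemma 2). Conrey's values `κ′_m ≥ .8137, .9584, .9873, .9962, .99874`
(`m = 1, …, 5`, Levinson's method) are NOT proved here.
[cite: Conrey1983, §1 (p. 49), Corollary (p. 50)] [cite: AlpogeFurman2026, Theorem A (i) and Remark 7.1] -/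
theorem two_thirds_le_xiDerivCriticalLineProportion (m : ℕ) :
    (2 / 3 : ℝ) ≤ xiDerivCriticalLineProportion m :=
  le_xiDerivCriticalLineProportion_of_simpleCritical m AlpogeFurman2026_simple_critical_holds

/-- **`κ′_m ≥ 2 − c_MT⁻¹` for every `m`** (the Montgomery–Taylor simple-critical proportion of [AF26]
Theorem A). [cite: AlpogeFurman2026, Theorem A (p. 1) and Remark 7.1] [cite: Conrey1983, §1 (p. 49)] -/
theorem two_sub_montgomeryTaylorInvConstant_le_xiDerivCriticalLineProportion (m : ℕ) :
    2 - montgomeryTaylorInvConstant ≤ xiDerivCriticalLineProportion m :=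
  le_xiDerivCriticalLineProportion_of_simpleCritical m AlpogeFurman2026_simple_critical_MT_cumulative

/-- Numerically: **`κ′_m ≥ 0.6725` for every `m`**, unconditionally.
[cite: AlpogeFurman2026, Theorem A (p. 1) and Remark 7.1] -/
theorem xiDerivCriticalLineProportion_ge_06725 (m : ℕ) :
    (0.6725 : ℝ) ≤ xiDerivCriticalLineProportion m :=
  le_xiDerivCriticalLineProportion_of_simpleCritical m AlpogeFurman2026_simple_critical_MT_cumulative'

/-! ## §11. Local density and multiplicities of the zeros of `ξ^{(m)}` -/

/-- **`N^{(m)}(T) − N^{(m)}(T − 1) = O_m(log T)`**: the zeros of `ξ^{(m)}` with `T − 1 < Im s ≤ T` number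
`O_m(log T)` (with multiplicity) — from `N^{(m)} = N + O(log T)` at `T` and `T − 1` and
`N(T) − N(T−1) = O(log T)` (Titchmarsh Thm. 9.2, tree `isBigO_zetaZeroCount_sub_zetaZeroCount_sub_one`).
[cite: Conrey1983, Lemma 2 (p. 52)] [cite: Titchmarsh1986, Thm. 9.2] -/
theorem isBigO_xiDerivZeroCount_sub_sub_one (m : ℕ) :
    (fun T : ℝ ↦ (xiDerivZeroCount m T : ℝ) - xiDerivZeroCount m (T - 1)) =O[atTop] Real.log := by
  obtain ⟨C, T₀, hT₀, hC⟩ := exists_abs_xiDerivZeroCount_sub_zetaZeroCount_le_log_all m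
  have h1 : (fun T : ℝ ↦ (xiDerivZeroCount m T : ℝ) - zetaZeroCount T) =O[atTop] Real.log := by
    refine Asymptotics.IsBigO.of_bound C ?_
    filter_upwards [eventually_ge_atTop T₀, eventually_ge_atTop (1 : ℝ)] with T hT hT1
    rw [Real.norm_eq_abs, Real.norm_eq_abs, abs_of_nonneg (Real.log_nonneg hT1)]
    exact hC T hT
  have h2 : (fun T : ℝ ↦ (xiDerivZeroCount m (T - 1) : ℝ) - zetaZeroCount (T - 1)) =O[atTop]
      Real.log := by
    refine Asymptotics.IsBigO.of_bound |C| ?_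
    filter_upwards [eventually_ge_atTop (T₀ + 1), eventually_ge_atTop (2 : ℝ)] with T hT hT2
    have hle := hC (T - 1) (by linarith)
    have hlog : Real.log (T - 1) ≤ Real.log T := Real.log_le_log (by linarith) (by linarith)
    have hlog0 : 0 ≤ Real.log (T - 1) := Real.log_nonneg (by linarith)
    rw [Real.norm_eq_abs, Real.norm_eq_abs, abs_of_nonneg (Real.log_nonneg (by linarith))]
    calc |(xiDerivZeroCount m (T - 1) : ℝ) - zetaZeroCount (T - 1)| ≤ C * Real.log (T - 1) := hle
      _ ≤ |C| * Real.log (T - 1) := mul_le_mul_of_nonneg_right (le_abs_self C) hlog0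
      _ ≤ |C| * Real.log T := mul_le_mul_of_nonneg_left hlog (abs_nonneg C)
  have h3 := isBigO_zetaZeroCount_sub_zetaZeroCount_sub_one
  exact ((h1.add h3).sub h2).congr_left fun T ↦ by ring

/-- **The multiplicity of a zero `ρ` of `ξ^{(m)}` (with `Im ρ > 0`) is at most
`N^{(m)}(Im ρ) − N^{(m)}(Im ρ − 1)`.** [cite: Conrey1983, Lemma 2 (p. 52)] -/
theorem analyticOrderAt_toNat_le_xiDerivZeroCount_sub (m : ℕ) {ρ : ℂ}
    (hρ : iteratedDeriv m riemannXi ρ = 0) (him : 0 < ρ.im) :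
    (analyticOrderAt (iteratedDeriv m riemannXi) ρ).toNat ≤
      xiDerivZeroCount m ρ.im - xiDerivZeroCount m (ρ.im - 1) := by
  classical
  have hB := XiDerivCritical.xiDerivZeroBox_finite m ρ.im
  have hB' := XiDerivCritical.xiDerivZeroBox_finite m (ρ.im - 1)
  have hsub : hB'.toFinset ⊆ hB.toFinset := by
    intro s hs
    rw [Set.Finite.mem_toFinset] at hs ⊢
    exact ⟨hs.1, hs.2.1, hs.2.2.trans (by linarith)⟩
  have hρmem : ρ ∈ hB.toFinset \ hB'.toFinset := by
    rw [Finset.mem_sdiff, Set.Finite.mem_toFinset, Set.Finite.mem_toFinset]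
    exact ⟨⟨hρ, him, le_rfl⟩, fun h ↦ by linarith [h.2.2]⟩
  unfold xiDerivZeroCount
  rw [finsum_mem_eq_finite_toFinset_sum _ hB, finsum_mem_eq_finite_toFinset_sum _ hB',
    ← Finset.sum_sdiff hsub, Nat.add_sub_cancel]
  exact Finset.single_le_sum (f := fun s ↦ (analyticOrderAt (iteratedDeriv m riemannXi) s).toNat)
    (fun _ _ ↦ Nat.zero_le _) hρmem

/-- **The zeros of `ξ^{(m)}` have multiplicity `O_m(log Im ρ)`**: there are `C` and `T₀` with
`mult(ρ) ≤ C log(Im ρ)` for every zero `ρ` of `ξ^{(m)}` with `Im ρ ≥ T₀`.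
[cite: Conrey1983, Lemma 2 (p. 52)] [cite: Titchmarsh1986, Thm. 9.2] -/
theorem exists_analyticOrderAt_iteratedDeriv_riemannXi_le_log (m : ℕ) :
    ∃ C T₀ : ℝ, 0 < T₀ ∧ ∀ ρ : ℂ, iteratedDeriv m riemannXi ρ = 0 → T₀ ≤ ρ.im →
      ((analyticOrderAt (iteratedDeriv m riemannXi) ρ).toNat : ℝ) ≤ C * Real.log ρ.im := by
  obtain ⟨C, hC⟩ := Asymptotics.isBigO_iff.1 (isBigO_xiDerivZeroCount_sub_sub_one m)
  obtain ⟨T₀, hT₀⟩ := Filter.eventually_atTop.1 (hC.and (eventually_ge_atTop (1 : ℝ)))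
  refine ⟨C, max T₀ 1, by positivity, fun ρ hρ hT ↦ ?_⟩
  obtain ⟨h1, h2⟩ := hT₀ ρ.im ((le_max_left _ _).trans hT)
  have him : 0 < ρ.im := by linarith [le_max_right T₀ 1]
  have hle := analyticOrderAt_toNat_le_xiDerivZeroCount_sub m hρ him
  have hmono : xiDerivZeroCount m (ρ.im - 1) ≤ xiDerivZeroCount m ρ.im :=
    xiDerivZeroCount_mono m (by linarith)
  have hcast : ((analyticOrderAt (iteratedDeriv m riemannXi) ρ).toNat : ℝ) ≤
      (xiDerivZeroCount m ρ.im : ℝ) - xiDerivZeroCount m (ρ.im - 1) := by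
    have := (Nat.cast_le (α := ℝ)).2 hle
    rw [Nat.cast_sub hmono] at this
    exact this
  rw [Real.norm_eq_abs, Real.norm_eq_abs, abs_of_nonneg (Real.log_nonneg h2)] at h1
  exact hcast.trans ((le_abs_self _).trans h1)

end Literature.NumberTheory.LFunctions

end
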